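import Literature.Barriers.CriticalPhenomena.PlanarEdwardsModelDiffusiveStoll
import Literature.Barriers.CriticalPhenomena.PlanarEdwardsModelDiffusiveProofs
import Literature.Barriers.CriticalPhenomena.PlanarEdwardsModelDiffusiveSILTMoments
import Literature.Probability.Process.PathSpaceBorel
import Literature.Probability.Process.PathSpaceFddConvergence
import Literature.Barriers.CriticalPhenomena.PlanarEdwardsModelDiffusiveScaledPathTight
import Mathlib.MeasureTheory.Measure.Portmanteau
import Mathlib.Probability.UniformOn
import HarnessLib

/-!
# Stoll's invariance principle — proved glue (§3 of the source in standard dress)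

Sibling proof file of `Literature.Barriers.CriticalPhenomena.PlanarEdwardsModelDiffusiveStoll`
(the named fact `Edwards2D.Stoll1989_invariance`: Stoll's `P_G` = the planar Domb–Joyce model in
the Edwards window converges weakly to Varadhan's polymer measure; A. Stoll, *Invariance
principles for Brownian intersection local time and polymer measures*, Math. Scand. 64 (1989),
133–160, Main Theorem 3.3 and Corollary 3.4 (ii); BiBoS II version LNM 1250, Main theorem 19 and
Corollary 20). Everything here is PROVED (no new definitions, no new named facts).

## What the source does in §3 and what is formalised here

After the moment estimates of §§1–2, §3 of the source shows `Ź = E exp(-g Φτ́)` finite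
(Prop. 3.2, Nelson's trick), concludes that "the internal density `dυ/dP` … belongs to the class
`SL^p` … for all real `p > 1`", identifies its standard part `°exp[-g Φτ́] = exp[-g mĺ]` (37),
gets `∞ > °Ź = Ż`, defines `ν` by `dν/dμ ∘ W̄ = (1/Ż) exp[-g mĺ]` (39) and reads off the Main
Theorem 3.3 `ν = L(υ) ∘ W̄⁻¹`, whose standard shadow is the invariance principle Cor. 3.4 (ii).
In standard language this last step is: *joint convergence in law of (walk, centred energy) plus
uniformly bounded `p`-th moments of the Boltzmann factors implies weak convergence of the
normalised Gibbs tilts*. This file proves exactly that (with `p = 2`) and the bookkeeping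
identifying both sides of the named fact with such tilts:

* `integral_dombJoyceWindowLaw`, `integral_dombJoyceWindowLaw_eq_edwardsAvg`: `∫ f dP_G` is the
  discrete Edwards average `⟨f ∘ W̄_n⟩_{Q^{g/2}_n}` of the sibling file
  (`edwardsAvg (g/2) n`, energy `J̄_n = (2/n)(J - ⟨J⟩)`, so `(g/2)J̄_n = (g/n)(J - ⟨J⟩)`: the
  centring constant cancels against the partition function);
* `integral_uniformOn_stepSeq`: uniform expectation on the `4ⁿ` walks is `Finset.expect`;
* `abs_integral_mul_exp_neg_sub_trunc_le`: truncation estimate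
  `|E f(Y)e^{-K} - E f(Y) min(e^{-K}, M)| ≤ ‖f‖ E e^{-2K} / M`;
* `integrable_exp_neg_two_of_tendsto_law`: `E e^{-2H_n} ≤ C` and `H_n → H` in law give
  `E e^{-2H} ≤ C` ("`∞ > °Ź = Ż`", lower semicontinuity);
* `tendsto_integral_mul_exp_neg_of_tendsto_law`: **Gibbs tilts along a sequence converging in
  law** — `(X_n, H_n) → (X, H)` in law and `sup_n E e^{-2H_n} < ∞` imply
  `E f(X_n)e^{-H_n} → E f(X)e^{-H}` for bounded continuous `f`;
* `integral_normalised_map_polymerTilt`: `∫ f d(Ż⁻¹ (e^{-λγ}·P) ∘ path⁻¹) = E[f(path)e^{-λγ}]/E[e^{-λγ}]`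
  ((39) of the source);
* `tendsto_integral_dombJoyceWindowLaw_of_core` and `Stoll1989_invariance_of_core`: the named
  fact follows from its two probabilistic cores — (J) the pairs (rescaled polygonal walk,
  `(g/2)J̄_n`) under the simple random walk converge in law on `C([0,1], ℂ) × ℝ` to
  (Brownian path, `gγ`) (the invariance principle for the renormalised intersection local time,
  §§1–2 and Cor. 2.5 (ii) of the source, with Donsker's theorem), and (U)
  `sup_n ⟨e^{-gJ̄_n}⟩ < ∞` for every `g > 0` (Prop. 3.2 of the source) — which remain to be
  formalised; integrability of `e^{-gγ}` (Varadhan) is then a consequence, not an input.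

* `exists_forall_expect_exp_neg_mul_jbar_le`: core (U) HOLDS — it is Lawler's (6.7), proved in
  `PlanarEdwardsModelDiffusiveProofs` (`Lawler1991_eq67_holds`); hence
  `Stoll1989_invariance_of_jointLaw`: the named fact follows from core (J) alone;
* `tendsto_integral_comp_of_coupling`: convergence in law from couplings on varying probability
  spaces (Billingsley's Theorem 3.1: `law(B_n) = law(B')`, `dist(A_n, B_n) → 0` in probability
  ⇒ `A_n → B'` in law) — the form in which core (J) is to be obtained from a strong
  approximation of the walk and of its intersection local time.

* `continuous_mollify`, `norm_mollify_le`, `mollifiedSILT_eq_mollify_path`: the Gaussian-mollified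
  self-intersection functional `Φ_k(p) = ∫₀¹∫₀¹ g_k(p(s) - p(t)) ds dt` is bounded and continuous on
  `C([0,1], ℂ)` (dominated convergence) and `mollifiedSILT Z k = Φ_k ∘ (t ↦ Z_t)`;
* `tendsto_integral_pair_of_approx`: convergence in law of pairs `(X_n, H_n) → (X', H')` from
  `X_n → X'` in law plus `L¹` approximation of the real companions by centred bounded continuous
  functionals `Ψ_k` of the first coordinate, uniformly in large `n` (Billingsley's Theorem 3.2
  in the form needed here);
* `jointLaw_of_donsker_of_mollify`, `Stoll1989_invariance_of_donsker_of_mollify`: core (J), hence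
  the named fact, from (D) **Donsker's invariance principle** for the planar simple random walk
  and (α) **the discrete renormalisation estimate** (uniform-in-`n` `L¹` approximation of
  `J̄_n/2` by `Φ_k(W̄_n) - ⟨Φ_k(W̄_n)⟩`) — the two inputs that remain to be formalised; the
  Brownian side of the `k → ∞` limit is the fact's own hypothesis on `γ`.

* `donsker_of_isTightMeasureSet_of_tendsto_fdd`, `Stoll1989_invariance_of_isTight_of_fdd_of_mollify`:
  core (D) (Donsker) assembled by Prokhorov from (D-a) tightness of the laws of `scaledPath n` on
  `C([0,1], ℂ)` and (D-b) convergence of their finite-dimensional distributions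
  (`Literature.Probability.Process.tendsto_of_isTightMeasureSet_of_tendsto_fdd`); (D-a) being PROVED in
  `PlanarEdwardsModelDiffusiveScaledPathTight` (`isTightMeasureSet_scaledPath`), the named fact follows from
  (D-b) and (α) alone: `Stoll1989_invariance_of_fdd_of_mollify`.

## References

* A. Stoll, Math. Scand. 64 (1989), 133–160, §3 (Prop. 3.2, (37)–(39), Main Theorem 3.3,
  Cor. 3.4). [Stoll1989]
* G. F. Lawler, *Intersections of Random Walks* (1991), §6.4 (discrete Edwards model `Q^β`).
  [Lawler1991]
* P. Billingsley, *Convergence of Probability Measures* (1999), §7 (random elements of `C`),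
  Theorems 3.1–3.2 (convergence in law from couplings / approximations), Theorem 8.2 (Donsker).
  [Billingsley1999]
* J.-F. Le Gall, Sém. Prob. XIX, LNM 1123 (1985), §0 (the kernels `g_k`). [LeGall1985]
-/

noncomputable section

open MeasureTheory ProbabilityTheory Filter Topology Finset unitInterval
open scoped NNReal ENNReal BigOperators BoundedContinuousFunction

namespace Literature.Barriers.CriticalPhenomena

namespace Edwards2D

open Literature.Probability.LatticeModels

/-! ### Glue, step 1: integration against Stoll's `P_G` is a finite Gibbs average -/

variable {n : ℕ}

/-- Integration against `P_G` (`dombJoyceWindowLaw g n`) is the finite Gibbs average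
`Σ_ω e^{-(g/n)J(ω)} f(W̄_n ω) / Σ_ω e^{-(g/n)J(ω)}` over the `4ⁿ` walks (Stoll's (30):
`P_{Θ,Φ,G}({ω}) = exp[-G τ(ω)] / E exp[-G τ]`, pushed forward along `scaledPath`).
[cite: Stoll1989, BiBoS II version, (30) and Corollary 20] -/
theorem integral_dombJoyceWindowLaw (g : ℝ) (n : ℕ) (f : C(I, ℂ) → ℝ) :
    ∫ x, f x ∂(dombJoyceWindowLaw g n) =
      (∑ ω : StepSeq n, windowWeight g n ω * f (scaledPath n ω)) /
        ∑ ω : StepSeq n, windowWeight g n ω := by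
  have hZ := sum_windowWeight_pos g n
  unfold dombJoyceWindowLaw
  rw [integral_finsetSum_measure]
  · simp_rw [integral_smul_measure, integral_dirac]
    rw [Finset.sum_div]
    refine Finset.sum_congr rfl fun ω _ => ?_
    rw [ENNReal.toReal_ofReal (div_pos (windowWeight_pos g n ω) hZ).le, smul_eq_mul,
      div_mul_eq_mul_div]
  · intro ω _
    refine Integrable.smul_measure ?_ ENNReal.ofReal_ne_top
    exact (integrable_const (f (scaledPath n ω))).congr (ae_eq_dirac f).symm

/-- The Domb–Joyce weight in the Edwards window is Lawler's discrete Edwards weight at `β = g/2`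
up to the constant `e^{(g/n)⟨J⟩}`: `exp(-(g/2) J̄(ω)) = exp(-(g/n) J(ω)) · exp((g/n)⟨J⟩)` with
`J̄ = (2/n)(J - ⟨J⟩)` (`jbar`). [cite: Lawler1991, §6.4 (J̄, Q^β)] -/
theorem exp_neg_half_mul_jbar (g : ℝ) (n : ℕ) (ω : StepSeq n) :
    Real.exp (-(g / 2 * jbar n ω)) =
      windowWeight g n ω * Real.exp (g / n * meanSelfIntersections n) := by
  unfold windowWeight jbar
  rw [← Real.exp_add]
  congr 1
  ring

/-- **`P_G` is the discrete Edwards model `Q^{g/2}_n` on path space**: for every `f`,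
`∫ f dP_G = ⟨f ∘ W̄_n⟩_{Q^{g/2}_n}` (`edwardsAvg (g/2) n`, the Gibbs average with energy
`J̄ = (2/n)(J - ⟨J⟩)`); the centring constant `e^{(g/n)⟨J⟩}` cancels between numerator and
partition function. [cite: Lawler1991, §6.4 (Q^β = discrete Edwards model)]
[cite: Stoll1989, BiBoS II version, (30), (33)] -/
theorem integral_dombJoyceWindowLaw_eq_edwardsAvg (g : ℝ) (n : ℕ) (f : C(I, ℂ) → ℝ) :
    ∫ x, f x ∂(dombJoyceWindowLaw g n) = edwardsAvg (g / 2) n fun ω => f (scaledPath n ω) := by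
  rw [integral_dombJoyceWindowLaw]
  unfold edwardsAvg gibbsAvg
  have hc : (0 : ℝ) < #(univ : Finset (StepSeq n)) := by
    exact_mod_cast Finset.card_pos.2 Finset.univ_nonempty
  rw [Finset.expect_eq_sum_div_card, Finset.expect_eq_sum_div_card,
    div_div_div_cancel_right₀ hc.ne']
  simp_rw [exp_neg_half_mul_jbar, ← mul_assoc, ← Finset.sum_mul]
  rw [mul_div_mul_right _ _ (Real.exp_pos _).ne']
  congr 1
  exact Finset.sum_congr rfl fun ω _ => mul_comm _ _

/-- Expectation under the uniform probability measure on the finite type of `n`-step walks is the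
uniform average `𝔼 ω, F ω` (`Finset.expect`), Lawler's `⟨F⟩_P`. [folklore] -/
theorem integral_uniformOn_stepSeq (F : StepSeq n → ℝ) :
    ∫ ω, F ω ∂(uniformOn (Set.univ : Set (StepSeq n))) = 𝔼 ω, F ω := by
  rw [integral_fintype (.of_finite), Finset.expect_eq_sum_div_card, Finset.sum_div]
  refine Finset.sum_congr rfl fun ω _ => ?_
  rw [measureReal_def, uniformOn_univ, Measure.count_singleton, smul_eq_mul, Finset.card_univ,
    ENNReal.toReal_div, ENNReal.toReal_one, ENNReal.toReal_natCast, one_div, inv_mul_eq_div]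


/-! ### Glue, step 2: Gibbs tilts along a sequence converging in law

Stoll's last step (§3 of the Math. Scand. paper, after Prop. 3.2: "Proposition 3.2 implies that the
internal density `dυ/dP` belongs to the class `SL^p` for all real `p > 1` … `∞ > °Ź = Ż`") in
standard dress: if `(X_n, H_n) → (X, H)` in law (bounded continuous test functions on `E × ℝ`)
and the Boltzmann factors have uniformly bounded second moments, `E e^{-2H_n} ≤ C`, then
`E e^{-2H} ≤ C` and `E f(X_n) e^{-H_n} → E f(X) e^{-H}` for every bounded continuous `f`. -/

section Tilting

variable {E : Type*} [TopologicalSpace E]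

/-- Bounded continuous truncations `(x, h) ↦ f(x) · min(e^{-h}, M)` of the tilted test function.
[folklore] -/
theorem exists_boundedContinuous_mul_min_exp (f : E →ᵇ ℝ) {M : ℝ} (hM : 0 ≤ M) :
    ∃ φ : E × ℝ →ᵇ ℝ, ∀ z, φ z = f z.1 * min (Real.exp (-z.2)) M := by
  refine ⟨BoundedContinuousFunction.ofNormedAddCommGroup
      (fun z : E × ℝ => f z.1 * min (Real.exp (-z.2)) M) ?_ (‖f‖ * M) ?_, fun z => rfl⟩
  · exact (f.continuous.comp continuous_fst).mul
      ((Real.continuous_exp.comp continuous_snd.neg).min continuous_const)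
  · intro z
    rw [norm_mul, Real.norm_of_nonneg (le_min (Real.exp_pos _).le hM)]
    exact mul_le_mul (f.norm_coe_le_norm z.1) (min_le_right _ _)
      (le_min (Real.exp_pos _).le hM) (norm_nonneg _)

/-- Bounded continuous truncations `h ↦ min(e^{-2h}, M)`. [folklore] -/
theorem exists_boundedContinuous_min_exp_two {M : ℝ} (hM : 0 ≤ M) :
    ∃ ψ : ℝ →ᵇ ℝ, ∀ h, ψ h = min (Real.exp (-(2 * h))) M := by
  refine ⟨BoundedContinuousFunction.ofNormedAddCommGroup
      (fun h : ℝ => min (Real.exp (-(2 * h))) M) ?_ M ?_, fun h => rfl⟩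
  · exact (Real.continuous_exp.comp (continuous_const.mul continuous_id).neg).min continuous_const
  · intro h
    rw [Real.norm_of_nonneg (le_min (Real.exp_pos _).le hM)]
    exact min_le_right _ _

/-- The truncation error of a Boltzmann factor is controlled by its square:
`e^{-h} - min(e^{-h}, M) ≤ e^{-2h} / M` for `M > 0`. [folklore] -/
theorem exp_neg_sub_min_le {M : ℝ} (hM : 0 < M) (h : ℝ) :
    Real.exp (-h) - min (Real.exp (-h)) M ≤ Real.exp (-(2 * h)) / M := by
  rcases le_or_gt (Real.exp (-h)) M with hle | hlt
  · rw [min_eq_left hle, sub_self]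
    positivity
  · rw [min_eq_right hlt.le, le_div_iff₀ hM, show -(2 * h) = -h + -h by ring, Real.exp_add]
    nlinarith [Real.exp_pos (-h), hlt]

/-- `e^{-h} ≤ 1 + e^{-2h}`. [folklore] -/
theorem exp_neg_le_one_add_exp_neg_two (h : ℝ) : Real.exp (-h) ≤ 1 + Real.exp (-(2 * h)) := by
  rw [show -(2 * h) = -h + -h by ring, Real.exp_add]
  nlinarith [Real.exp_pos (-h), sq_nonneg (Real.exp (-h) - 1)]

variable [MeasurableSpace E] [OpensMeasurableSpace E]

/-- **Truncation estimate**: on a finite measure space, for `f` bounded continuous, `Y` and `K`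
measurable, `|∫ f(Y) e^{-K} - ∫ f(Y) min(e^{-K}, M)| ≤ ‖f‖ · (∫ e^{-2K}) / M`. [folklore] -/
theorem abs_integral_mul_exp_neg_sub_trunc_le {Ω₀ : Type*} [MeasurableSpace Ω₀] {Q : Measure Ω₀}
    [IsFiniteMeasure Q] {Y : Ω₀ → E} {K : Ω₀ → ℝ} (hY : AEMeasurable Y Q) (hK : AEMeasurable K Q)
    (hK2 : Integrable (fun ω => Real.exp (-(2 * K ω))) Q) (f : E →ᵇ ℝ) {M : ℝ} (hM : 0 < M) :
    |∫ ω, f (Y ω) * Real.exp (-K ω) ∂Q - ∫ ω, f (Y ω) * min (Real.exp (-K ω)) M ∂Q| ≤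
      ‖f‖ * (∫ ω, Real.exp (-(2 * K ω)) ∂Q) / M := by
  have hfY : AEStronglyMeasurable (fun ω => f (Y ω)) Q :=
    (f.continuous.measurable.comp_aemeasurable hY).aestronglyMeasurable
  have heK : AEMeasurable (fun ω => Real.exp (-K ω)) Q :=
    Real.continuous_exp.measurable.comp_aemeasurable hK.neg
  have h1 : Integrable (fun ω => f (Y ω) * Real.exp (-K ω)) Q := by
    refine Integrable.mono' (((integrable_const (1 : ℝ)).add hK2).const_mul ‖f‖)
      (hfY.mul heK.aestronglyMeasurable) (ae_of_all _ fun ω => ?_)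
    rw [norm_mul, Real.norm_of_nonneg (Real.exp_pos _).le]
    exact mul_le_mul (f.norm_coe_le_norm _) (exp_neg_le_one_add_exp_neg_two _)
      (Real.exp_pos _).le (norm_nonneg _)
  have h2 : Integrable (fun ω => f (Y ω) * min (Real.exp (-K ω)) M) Q := by
    refine Integrable.mono' (integrable_const (‖f‖ * M))
      (hfY.mul (heK.min aemeasurable_const).aestronglyMeasurable) (ae_of_all _ fun ω => ?_)
    rw [norm_mul, Real.norm_of_nonneg (le_min (Real.exp_pos _).le hM.le)]
    exact mul_le_mul (f.norm_coe_le_norm _) (min_le_right _ _)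
      (le_min (Real.exp_pos _).le hM.le) (norm_nonneg _)
  rw [← integral_sub h1 h2]
  calc |∫ ω, (f (Y ω) * Real.exp (-K ω) - f (Y ω) * min (Real.exp (-K ω)) M) ∂Q|
      ≤ ∫ ω, |f (Y ω) * Real.exp (-K ω) - f (Y ω) * min (Real.exp (-K ω)) M| ∂Q :=
        abs_integral_le_integral_abs
    _ ≤ ∫ ω, ‖f‖ * (Real.exp (-(2 * K ω)) / M) ∂Q := by
        refine integral_mono_of_nonneg (ae_of_all _ fun ω => abs_nonneg _)
          ((hK2.div_const M).const_mul ‖f‖) (ae_of_all _ fun ω => ?_)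
        dsimp only
        rw [← mul_sub, abs_mul]
        refine mul_le_mul (f.norm_coe_le_norm (Y ω)) ?_ (abs_nonneg _) (norm_nonneg _)
        rw [abs_of_nonneg (sub_nonneg.2 (min_le_left _ _))]
        exact exp_neg_sub_min_le hM (K ω)
    _ = ‖f‖ * (∫ ω, Real.exp (-(2 * K ω)) ∂Q) / M := by
        rw [integral_const_mul, integral_div, mul_div_assoc]

variable {Ωs : ℕ → Type*} [∀ n, MeasurableSpace (Ωs n)] {μ : ∀ n, Measure (Ωs n)}
  {Ω' : Type*} [MeasurableSpace Ω'] {P : Measure Ω'} [IsProbabilityMeasure P]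
  {H : ∀ n, Ωs n → ℝ} {H' : Ω' → ℝ}

omit [MeasurableSpace E] [OpensMeasurableSpace E] [TopologicalSpace E] in
/-- **Lower semicontinuity transfer of the Boltzmann bound** ("`∞ > °Ź = Ż`"): if `H_n → H` in
law and `E e^{-2H_n} ≤ C` for all `n`, then `e^{-2H}` is integrable with `E e^{-2H} ≤ C`.
[cite: Stoll1989, §3, proof following Prop. 3.2 ((37) and `∞ > °Ź = Ż`)] -/
theorem integrable_exp_neg_two_of_tendsto_law (hH' : AEMeasurable H' P)
    (hlaw : ∀ ψ : ℝ →ᵇ ℝ,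
      Tendsto (fun n => ∫ ω, ψ (H n ω) ∂μ n) atTop (𝓝 (∫ ω, ψ (H' ω) ∂P)))
    {C : ℝ} (hint : ∀ n, Integrable (fun ω => Real.exp (-(2 * H n ω))) (μ n))
    (hC : ∀ n, ∫ ω, Real.exp (-(2 * H n ω)) ∂μ n ≤ C) :
    Integrable (fun ω => Real.exp (-(2 * H' ω))) P ∧ ∫ ω, Real.exp (-(2 * H' ω)) ∂P ≤ C := by
  have hC0 : 0 ≤ C := (integral_nonneg fun ω => (Real.exp_pos _).le).trans (hC 0)
  have key : ∀ M : ℕ, ∫ ω, min (Real.exp (-(2 * H' ω))) M ∂P ≤ C := by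
    intro M
    obtain ⟨ψ, hψ⟩ := exists_boundedContinuous_min_exp_two (M := (M : ℝ)) M.cast_nonneg
    have h1 : Tendsto (fun n => ∫ ω, ψ (H n ω) ∂μ n) atTop (𝓝 (∫ ω, ψ (H' ω) ∂P)) := hlaw ψ
    simp_rw [hψ] at h1
    refine le_of_tendsto' h1 fun n => (integral_mono_of_nonneg ?_ (hint n) ?_).trans (hC n)
    · exact ae_of_all _ fun ω => le_min (Real.exp_pos _).le M.cast_nonneg
    · exact ae_of_all _ fun ω => min_le_left _ _
  have hmeas : AEStronglyMeasurable (fun ω => Real.exp (-(2 * H' ω))) P := by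
    exact (Real.continuous_exp.measurable.comp_aemeasurable
      ((hH'.const_mul 2).neg)).aestronglyMeasurable
  have hmeasM : ∀ M : ℕ,
      AEStronglyMeasurable (fun ω => min (Real.exp (-(2 * H' ω))) (M : ℝ)) P :=
    fun M => hmeas.aemeasurable.min aemeasurable_const |>.aestronglyMeasurable
  have hintM : ∀ M : ℕ, Integrable (fun ω => min (Real.exp (-(2 * H' ω))) (M : ℝ)) P := by
    intro M
    refine Integrable.mono' (integrable_const (M : ℝ)) (hmeasM M) (ae_of_all _ fun ω => ?_)
    rw [Real.norm_of_nonneg (le_min (Real.exp_pos _).le M.cast_nonneg)]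
    exact min_le_right _ _
  have hsup : ∀ ω, (⨆ M : ℕ, ENNReal.ofReal (min (Real.exp (-(2 * H' ω))) (M : ℝ))) =
      ENNReal.ofReal (Real.exp (-(2 * H' ω))) := by
    intro ω
    refine le_antisymm (iSup_le fun M => ENNReal.ofReal_le_ofReal (min_le_left _ _)) ?_
    refine le_iSup_of_le ⌈Real.exp (-(2 * H' ω))⌉₊ (ENNReal.ofReal_le_ofReal ?_)
    exact le_min le_rfl (Nat.le_ceil _)
  have hlin : ∫⁻ ω, ENNReal.ofReal (Real.exp (-(2 * H' ω))) ∂P ≤ ENNReal.ofReal C := by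
    simp_rw [← hsup]
    rw [lintegral_iSup' (fun M => (hmeasM M).aemeasurable.ennreal_ofReal)
      (ae_of_all _ fun ω M M' hMM' => ENNReal.ofReal_le_ofReal
        (min_le_min_left _ (Nat.cast_le.2 hMM')))]
    refine iSup_le fun M => ?_
    rw [← ofReal_integral_eq_lintegral_ofReal (hintM M)
      (ae_of_all _ fun ω => le_min (Real.exp_pos _).le M.cast_nonneg)]
    exact ENNReal.ofReal_le_ofReal (key M)
  have hI : Integrable (fun ω => Real.exp (-(2 * H' ω))) P := by
    refine ⟨hmeas, (hasFiniteIntegral_iff_ofReal (ae_of_all _ fun ω => (Real.exp_pos _).le)).2 ?_⟩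
    exact hlin.trans_lt ENNReal.ofReal_lt_top
  refine ⟨hI, ?_⟩
  rw [integral_eq_lintegral_of_nonneg_ae (ae_of_all _ fun ω => (Real.exp_pos _).le) hmeas]
  exact ENNReal.toReal_le_of_le_ofReal hC0 hlin

variable [∀ n, IsProbabilityMeasure (μ n)] {X : ∀ n, Ωs n → E} {X' : Ω' → E}

/-- **Gibbs tilts along a sequence converging in law.** If `(X_n, H_n) → (X, H)` in law (test
functions bounded continuous on `E × ℝ`) and the Boltzmann factors `e^{-H_n}` have second moments
bounded uniformly in `n`, then `E[f(X_n) e^{-H_n}] → E[f(X) e^{-H}]` for every bounded continuous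
`f` — the tilted (unnormalised) laws converge. Stoll's concluding argument (`SL^p`-lifting of the
density, `p > 1`) in standard form, with `p = 2`.
[cite: Stoll1989, §3: Prop. 3.2 ⇒ "`dυ/dP` belongs to the class `SL^p` … for all real `p > 1`", (37)–(39), Main Theorem 3.3] -/
theorem tendsto_integral_mul_exp_neg_of_tendsto_law
    (hX : ∀ n, AEMeasurable (X n) (μ n)) (hH : ∀ n, AEMeasurable (H n) (μ n))
    (hX' : AEMeasurable X' P) (hH' : AEMeasurable H' P)
    (hlaw : ∀ φ : E × ℝ →ᵇ ℝ,
      Tendsto (fun n => ∫ ω, φ (X n ω, H n ω) ∂μ n) atTop (𝓝 (∫ ω, φ (X' ω, H' ω) ∂P)))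
    {C : ℝ} (hint : ∀ n, Integrable (fun ω => Real.exp (-(2 * H n ω))) (μ n))
    (hC : ∀ n, ∫ ω, Real.exp (-(2 * H n ω)) ∂μ n ≤ C) (f : E →ᵇ ℝ) :
    Tendsto (fun n => ∫ ω, f (X n ω) * Real.exp (-H n ω) ∂μ n) atTop
      (𝓝 (∫ ω, f (X' ω) * Real.exp (-H' ω) ∂P)) := by
  have hlawH : ∀ ψ : ℝ →ᵇ ℝ,
      Tendsto (fun n => ∫ ω, ψ (H n ω) ∂μ n) atTop (𝓝 (∫ ω, ψ (H' ω) ∂P)) := fun ψ => by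
    simpa using hlaw (ψ.compContinuous ContinuousMap.snd)
  obtain ⟨hI', hC'⟩ := integrable_exp_neg_two_of_tendsto_law hH' hlawH hint hC
  have hC0 : 0 ≤ C := (integral_nonneg fun ω => (Real.exp_pos _).le).trans (hC 0)
  rw [Metric.tendsto_atTop]
  intro ε hε
  -- truncation level
  set M : ℝ := 3 * (‖f‖ * C) / ε + 1 with hM_def
  have hM : 0 < M := by positivity
  have hMε : ‖f‖ * C / M < ε / 3 := by
    have hM3 : ε / 3 * M = ‖f‖ * C + ε / 3 := by
      rw [hM_def]
      field_simp
    rw [div_lt_iff₀ hM, hM3]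
    linarith
  obtain ⟨φ, hφ⟩ := exists_boundedContinuous_mul_min_exp f hM.le
  have hmid := hlaw φ
  simp_rw [hφ] at hmid
  rw [Metric.tendsto_atTop] at hmid
  obtain ⟨N, hN⟩ := hmid (ε / 3) (by positivity)
  refine ⟨N, fun n hn => ?_⟩
  have e1 := abs_integral_mul_exp_neg_sub_trunc_le (hX n) (hH n) (hint n) f hM
  have e2 := abs_integral_mul_exp_neg_sub_trunc_le hX' hH' hI' f hM
  have e1' : ‖f‖ * (∫ ω, Real.exp (-(2 * H n ω)) ∂μ n) / M < ε / 3 :=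
    lt_of_le_of_lt (by gcongr; exact hC n) hMε
  have e2' : ‖f‖ * (∫ ω, Real.exp (-(2 * H' ω)) ∂P) / M < ε / 3 :=
    lt_of_le_of_lt (by gcongr) hMε
  have e3 := hN n hn
  set a := ∫ ω, f (X n ω) * Real.exp (-H n ω) ∂μ n
  set b := ∫ ω, f (X n ω) * min (Real.exp (-H n ω)) M ∂μ n
  set c := ∫ ω, f (X' ω) * min (Real.exp (-H' ω)) M ∂P
  set d := ∫ ω, f (X' ω) * Real.exp (-H' ω) ∂P
  rw [Real.dist_eq] at e3 ⊢
  rw [abs_sub_comm] at e2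
  linarith [abs_sub_le a b d, abs_sub_le b c d]

end Tilting


/-! ### Glue, step 3: the polymer side and the reduction of Stoll's theorem to its two cores -/

universe u

section PolymerSide

variable {Ω : Type*} [MeasurableSpace Ω]

/-- Integration against the normalised polymer law `Ż⁻¹ (e^{-λγ} · P) ∘ path⁻¹`
(`polymerTilt`, normalised and pushed to path space) is the ratio
`E[f(path) e^{-λγ}] / E[e^{-λγ}]` (Stoll's (39): `dν/dμ ∘ W̄ = (1/Ż) exp[-g mĺ]`).
[cite: Stoll1989, §3, (39)] -/
theorem integral_normalised_map_polymerTilt (P : Measure Ω) [IsProbabilityMeasure P]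
    {γ : Ω → ℝ} (hγ : AEMeasurable γ P) {lam : ℝ}
    (hint : Integrable (fun ω => Real.exp (-(lam * γ ω))) P)
    {E : Type*} [TopologicalSpace E] [MeasurableSpace E] [OpensMeasurableSpace E]
    {path : Ω → E} (hpath : AEMeasurable path P) (f : E →ᵇ ℝ) :
    ∫ x, f x ∂(((polymerTilt P γ lam) Set.univ)⁻¹ • (polymerTilt P γ lam).map path) =
      (∫ ω, f (path ω) * Real.exp (-(lam * γ ω)) ∂P) / ∫ ω, Real.exp (-(lam * γ ω)) ∂P := by
  have hd : AEMeasurable (fun ω => ENNReal.ofReal (Real.exp (-(lam * γ ω)))) P :=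
    (Real.continuous_exp.measurable.comp_aemeasurable (hγ.const_mul lam).neg).ennreal_ofReal
  have hν : polymerTilt P γ lam =
      P.withDensity (fun ω => ENNReal.ofReal (Real.exp (-(lam * γ ω)))) := rfl
  have hZ : (polymerTilt P γ lam) Set.univ = ENNReal.ofReal (∫ ω, Real.exp (-(lam * γ ω)) ∂P) := by
    rw [hν, withDensity_apply _ MeasurableSet.univ, Measure.restrict_univ,
      ofReal_integral_eq_lintegral_ofReal hint (ae_of_all _ fun ω => (Real.exp_pos _).le)]
  have hZpos : 0 < ∫ ω, Real.exp (-(lam * γ ω)) ∂P := integral_exp_pos hint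
  rw [integral_smul_measure, hZ, ENNReal.toReal_inv, ENNReal.toReal_ofReal hZpos.le, hν,
    integral_map (hpath.mono_ac (withDensity_absolutelyContinuous _ _))
      f.continuous.aestronglyMeasurable,
    integral_withDensity_eq_integral_toReal_smul₀ hd
      (ae_of_all _ fun _ => ENNReal.ofReal_lt_top), smul_eq_mul, inv_mul_eq_div]
  congr 1
  refine integral_congr_ae (ae_of_all _ fun ω => ?_)
  dsimp only
  rw [ENNReal.toReal_ofReal (Real.exp_pos _).le, smul_eq_mul, mul_comm]

end PolymerSide

/-- **Reduction of Stoll's invariance principle to its two probabilistic cores.** Fix a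
probability space carrying a random path `path : Ω → C([0,1], ℂ)` and a random variable `γ`.
If (core J, "joint law") the pairs (rescaled polygonal walk, centred window energy
`(g/2) J̄_n = (g/n)(J - ⟨J⟩)`) under the simple random walk converge in law to `(path, g γ)`, and
(core U, "uniform integrability", Stoll's Prop. 3.2 with coupling `2g`) the Boltzmann factors
have uniformly bounded second moments `⟨e^{-g J̄_n}⟩ ≤ C`, then Stoll's `P_G`
(`dombJoyceWindowLaw g n`) converges weakly to the normalised polymer law
`Ż⁻¹ (e^{-gγ} · P) ∘ path⁻¹`; in particular `E e^{-gγ} < ∞` comes for free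
(`integrable_exp_neg_two_of_tendsto_law`). This is the architecture of §3 of the source
(Prop. 3.2 + (37) ⇒ Main Theorem 3.3 ⇒ Cor. 3.4 (ii)).
[cite: Stoll1989, §3: Prop. 3.2, (37)–(39), Main Theorem 3.3, Cor. 3.4 (ii)] -/
theorem tendsto_integral_dombJoyceWindowLaw_of_core {Ω : Type*} [MeasurableSpace Ω]
    {P : Measure Ω} [IsProbabilityMeasure P] {path : Ω → C(I, ℂ)} (hpath : AEMeasurable path P)
    {γ : Ω → ℝ} (hγ : AEMeasurable γ P) {g : ℝ}
    (hlaw : ∀ φ : C(I, ℂ) × ℝ →ᵇ ℝ,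
      Tendsto (fun n => 𝔼 ω : StepSeq n, φ (scaledPath n ω, g / 2 * jbar n ω)) atTop
        (𝓝 (∫ ω, φ (path ω, g * γ ω) ∂P)))
    {C : ℝ} (hexp : ∀ n : ℕ, 𝔼 ω : StepSeq n, Real.exp (-(2 * (g / 2 * jbar n ω))) ≤ C)
    (f : C(I, ℂ) →ᵇ ℝ) :
    Tendsto (fun n => ∫ x, f x ∂(dombJoyceWindowLaw g n)) atTop
      (𝓝 (∫ x, f x ∂(((polymerTilt P γ g) Set.univ)⁻¹ • (polymerTilt P γ g).map path))) := by
  set μ : ∀ n, Measure (StepSeq n) := fun n => uniformOn Set.univ with hμ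
  haveI : ∀ n, IsProbabilityMeasure (μ n) := fun n => by
    rw [hμ]; infer_instance
  have hlaw' : ∀ φ : C(I, ℂ) × ℝ →ᵇ ℝ,
      Tendsto (fun n => ∫ ω, φ (scaledPath n ω, g / 2 * jbar n ω) ∂μ n) atTop
        (𝓝 (∫ ω, φ (path ω, g * γ ω) ∂P)) := fun φ => by
    simp_rw [hμ, integral_uniformOn_stepSeq]
    exact hlaw φ
  have hint : ∀ n, Integrable (fun ω => Real.exp (-(2 * (g / 2 * jbar n ω)))) (μ n) :=
    fun n => .of_finite
  have hC : ∀ n, ∫ ω, Real.exp (-(2 * (g / 2 * jbar n ω))) ∂μ n ≤ C := fun n => by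
    rw [hμ, integral_uniformOn_stepSeq]
    exact hexp n
  have hXm : ∀ n, AEMeasurable (scaledPath n) (μ n) := fun n => (Measurable.of_discrete).aemeasurable
  have hHm : ∀ n, AEMeasurable (fun ω => g / 2 * jbar n ω) (μ n) :=
    fun n => (Measurable.of_discrete).aemeasurable
  have hH'm : AEMeasurable (fun ω => g * γ ω) P := hγ.const_mul g
  have key := fun f' : C(I, ℂ) →ᵇ ℝ =>
    tendsto_integral_mul_exp_neg_of_tendsto_law (μ := μ) (P := P) (X := fun n => scaledPath n)
      (H := fun n ω => g / 2 * jbar n ω) (X' := path) (H' := fun ω => g * γ ω)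
      hXm hHm hpath hH'm hlaw' hint hC f'
  -- integrability of the limiting Boltzmann factor (for free) and positivity of `Ż`
  have hlawH : ∀ ψ : ℝ →ᵇ ℝ, Tendsto (fun n => ∫ ω, ψ (g / 2 * jbar n ω) ∂μ n) atTop
      (𝓝 (∫ ω, ψ (g * γ ω) ∂P)) := fun ψ => by
    simpa using hlaw' (ψ.compContinuous ContinuousMap.snd)
  obtain ⟨hI2, -⟩ := integrable_exp_neg_two_of_tendsto_law (μ := μ) (P := P)
    (H := fun n ω => g / 2 * jbar n ω) (H' := fun ω => g * γ ω) hH'm hlawH hint hC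
  have hI1 : Integrable (fun ω => Real.exp (-(g * γ ω))) P := by
    refine Integrable.mono' ((integrable_const (1 : ℝ)).add hI2)
      (Real.continuous_exp.measurable.comp_aemeasurable hH'm.neg).aestronglyMeasurable
      (ae_of_all _ fun ω => ?_)
    rw [Real.norm_of_nonneg (Real.exp_pos _).le]
    exact exp_neg_le_one_add_exp_neg_two _
  have hZpos : 0 < ∫ ω, Real.exp (-(g * γ ω)) ∂P := integral_exp_pos hI1
  have hden : Tendsto (fun n => ∫ ω, Real.exp (-(g / 2 * jbar n ω)) ∂μ n) atTop
      (𝓝 (∫ ω, Real.exp (-(g * γ ω)) ∂P)) := by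
    simpa using key 1
  have hlim := (key f).div hden hZpos.ne'
  -- identify both sides
  rw [integral_normalised_map_polymerTilt P hγ hI1 hpath f]
  refine hlim.congr fun n => ?_
  simp only [hμ, Pi.div_apply]
  rw [integral_dombJoyceWindowLaw_eq_edwardsAvg, integral_uniformOn_stepSeq,
    integral_uniformOn_stepSeq]
  rfl

/-- The path map `ω ↦ (t ↦ Z_t(ω))` of a process with continuous paths and measurable marginals
is a random element of `C([0,1], ℂ)` (Borel σ-algebra of the uniform topology).
[cite: Billingsley1999, §7] -/
theorem measurable_pathMap {Ω : Type*} [MeasurableSpace Ω] (Z : ℝ≥0 → Ω → ℂ)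
    (hm : ∀ t, Measurable (Z t)) (hc : ∀ ω, Continuous (Z · ω)) :
    Measurable fun ω => (⟨fun t : I => Z (Real.toNNReal (t : ℝ)) ω,
      (hc ω).comp (continuous_real_toNNReal.comp continuous_subtype_val)⟩ : C(I, ℂ)) :=
  Literature.Probability.Process.measurable_continuousMap_of_eval fun _ => hm _

/-- **Stoll's invariance principle from its two cores** (the assembly of the named fact
`Stoll1989_invariance` modulo the two probabilistic inputs of the source, stated for every
planar Brownian motion and every `L²` limit `γ` of the centred mollified self-intersection local
times, exactly as the fact quantifies): (J) joint convergence in law of (rescaled walk, centred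
window energy) to (Brownian path, `gγ`) — the invariance principle for the renormalised
intersection local time, §§1–2 and Cor. 2.5 (ii) of the source together with Donsker's theorem;
(U) `sup_n ⟨e^{-g J̄_n}⟩ < ∞` for every `g > 0` — Prop. 3.2 of the source (Nelson's trick).
[cite: Stoll1989, §3, Main Theorem 3.3 and Cor. 3.4 (ii); Cor. 2.5 (ii); Prop. 3.2] -/
theorem Stoll1989_invariance_of_core
    (hJ : ∀ (g : ℝ), 0 < g →
      ∀ (Ω : Type u) [MeasurableSpace Ω] (P : Measure Ω) [IsProbabilityMeasure P]
        (Z : ℝ≥0 → Ω → ℂ), Literature.Probability.Process.IsBrownianComplex Z P →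
        (∀ t, Measurable (Z t)) → ∀ hc : ∀ ω, Continuous (Z · ω),
        ∀ γ : Ω → ℝ, MemLp γ 2 P →
          Tendsto (fun k : ℕ => eLpNorm (fun ω =>
            (mollifiedSILT Z k ω - ∫ ω', mollifiedSILT Z k ω' ∂P) - γ ω) 2 P) atTop (𝓝 0) →
          ∀ φ : C(I, ℂ) × ℝ →ᵇ ℝ,
            Tendsto (fun n => 𝔼 ω : StepSeq n, φ (scaledPath n ω, g / 2 * jbar n ω)) atTop
              (𝓝 (∫ ω, φ ((⟨fun t : I => Z (Real.toNNReal (t : ℝ)) ω,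
                (hc ω).comp (continuous_real_toNNReal.comp continuous_subtype_val)⟩ : C(I, ℂ)),
                g * γ ω) ∂P)))
    (hU : ∀ g : ℝ, 0 < g → ∃ C : ℝ, ∀ n : ℕ, 𝔼 ω : StepSeq n, Real.exp (-(g * jbar n ω)) ≤ C) :
    Stoll1989_invariance.{u} := by
  intro g hg Ω _ P _ Z hZ hm hc γ hγ hlim f
  obtain ⟨C, hC⟩ := hU g hg
  refine tendsto_integral_dombJoyceWindowLaw_of_core (measurable_pathMap Z hm hc).aemeasurable
    hγ.aestronglyMeasurable.aemeasurable (hJ g hg Ω P Z hZ hm hc γ hγ hlim) (C := C)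
    (fun n => ?_) f
  simpa [show ∀ x : ℝ, 2 * (g / 2 * x) = g * x from fun x => by ring] using hC n

/-! ### Core U is Lawler's (6.7), proved in `PlanarEdwardsModelDiffusiveProofs` -/

/-- **Core U of the reduction holds**: `sup_n ⟨e^{-gJ̄_n}⟩_P < ∞` for every `g > 0` — Lawler's
(6.7), which Lawler credits to Stoll ("With sharper estimates, see e.g. Stoll [68], one can
show …"), i.e. Prop. 3.2 of the source; PROVED in the sibling file
(`Lawler1991_eq67_holds`, constant `exp(256 g² e^{8g})` for `n ≥ 1`; `n = 0` is trivial since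
`J̄_0 = 0`). [cite: Lawler1991, §6.4, eq. (6.7)] [cite: Stoll1989, §3, Prop. 3.2] -/
theorem exists_forall_expect_exp_neg_mul_jbar_le {g : ℝ} (hg : 0 < g) :
    ∃ C : ℝ, ∀ n : ℕ, 𝔼 ω : StepSeq n, Real.exp (-(g * jbar n ω)) ≤ C := by
  obtain ⟨c, hc⟩ := Lawler1991_eq67_holds g hg
  refine ⟨max c 1, fun n => ?_⟩
  rcases Nat.eq_zero_or_pos n with rfl | hn
  · have h0 : ∀ ω : StepSeq 0, Real.exp (-(g * jbar 0 ω)) = 1 := fun ω => by simp [jbar]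
    simp_rw [h0, Finset.expect_const Finset.univ_nonempty]
    exact le_max_right _ _
  · exact (hc n hn).trans (le_max_left _ _)

/-! ### Convergence in law from couplings (Billingsley, Thm. 3.1), varying probability spaces -/

section Coupling

variable {Ωs : ℕ → Type*} [∀ n, MeasurableSpace (Ωs n)] {Q : ∀ n, Measure (Ωs n)}
  [∀ n, IsProbabilityMeasure (Q n)] {Ω' : Type*} [MeasurableSpace Ω'] {P : Measure Ω'}
  [IsProbabilityMeasure P] {M : Type*} [PseudoMetricSpace M] [MeasurableSpace M] [BorelSpace M]
  [SecondCountableTopology M] {A B : ∀ n, Ωs n → M} {B' : Ω' → M}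

omit [IsProbabilityMeasure P] [∀ n, IsProbabilityMeasure (Q n)] [BorelSpace M]
  [SecondCountableTopology M] in
/-- A bounded Lipschitz function of a random element is integrable (finite measure). [folklore] -/
theorem integrable_comp_of_lipschitz_of_bounded [OpensMeasurableSpace M] {X : Type*}
    [MeasurableSpace X] {ν : Measure X} [IsFiniteMeasure ν] {Y : X → M} (hY : AEMeasurable Y ν)
    {f : M → ℝ} {L : ℝ≥0} (hL : LipschitzWith L f) {K : ℝ} (hK : ∀ x, ‖f x‖ ≤ K) :
    Integrable (fun x => f (Y x)) ν :=
  Integrable.mono' (integrable_const K)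
    (hL.continuous.measurable.comp_aemeasurable hY).aestronglyMeasurable (ae_of_all _ fun _ => hK _)

/-- **Convergence in law from a coupling** (Billingsley's Theorem 3.1 on varying probability
spaces): if on the `n`-th probability space `A_n` is coupled to `B_n`, where every `B_n` has the
law of `B'` and `dist(A_n, B_n) → 0` in probability, then `A_n → B'` in law (bounded continuous
test functions). The form in which invariance principles are obtained from strong
approximations. [cite: Billingsley1999, Theorem 3.1] -/
theorem tendsto_integral_comp_of_coupling (hA : ∀ n, AEMeasurable (A n) (Q n))
    (hB : ∀ n, AEMeasurable (B n) (Q n)) (hB' : AEMeasurable B' P)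
    (hlawB : ∀ n, (Q n).map (B n) = P.map B')
    (hclose : ∀ ε : ℝ, 0 < ε →
      Tendsto (fun n => (Q n).real {ω | ε ≤ dist (A n ω) (B n ω)}) atTop (𝓝 0))
    (φ : M →ᵇ ℝ) :
    Tendsto (fun n => ∫ ω, φ (A n ω) ∂Q n) atTop (𝓝 (∫ ω, φ (B' ω) ∂P)) := by
  -- package the laws as probability measures
  set μs : ℕ → ProbabilityMeasure M :=
    fun n => ⟨(Q n).map (A n), Measure.isProbabilityMeasure_map (hA n)⟩ with hμs
  set μ : ProbabilityMeasure M := ⟨P.map B', Measure.isProbabilityMeasure_map hB'⟩ with hμ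
  suffices h : Tendsto μs atTop (𝓝 μ) by
    have := (ProbabilityMeasure.tendsto_iff_forall_integral_tendsto.1 h) φ
    simp only [hμs, hμ, ProbabilityMeasure.coe_mk] at this
    rw [integral_map hB' φ.continuous.aestronglyMeasurable] at this
    refine this.congr fun n => ?_
    rw [integral_map (hA n) φ.continuous.aestronglyMeasurable]
  rw [tendsto_iff_forall_lipschitz_integral_tendsto]
  rintro f ⟨C, hC⟩ ⟨L, hL⟩
  simp only [hμs, hμ, ProbabilityMeasure.coe_mk]
  rw [integral_map hB' hL.continuous.aestronglyMeasurable]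
  simp_rw [integral_map (hA _) hL.continuous.aestronglyMeasurable]
  -- `∫ f(B_n) dQ_n = ∫ f(B') dP`
  have hBn : ∀ n, ∫ ω, f (B n ω) ∂Q n = ∫ ω, f (B' ω) ∂P := fun n => by
    rw [← integral_map (hB n) hL.continuous.aestronglyMeasurable, hlawB n,
      integral_map hB' hL.continuous.aestronglyMeasurable]
  -- boundedness of `f`
  rcases isEmpty_or_nonempty M with hM | ⟨⟨x₀⟩⟩
  · have : ∀ n, (fun ω => f (A n ω)) = fun ω => f (B n ω) := fun n =>
      funext fun ω => (hM.false (A n ω)).elim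
    simp_rw [this, hBn]
    exact tendsto_const_nhds
  have hC0 : 0 ≤ C := dist_nonneg.trans (hC x₀ x₀)
  have hbd : ∀ x, ‖f x‖ ≤ ‖f x₀‖ + C := fun x => by
    have h1 := hC x x₀
    rw [Real.dist_eq] at h1
    have h2 := abs_add_le (f x₀) (f x - f x₀)
    rw [add_sub_cancel] at h2
    exact h2.trans (add_le_add le_rfl h1)
  rw [Metric.tendsto_atTop]
  intro δ hδ
  -- closeness scale `ε` with `L ε < δ/2`
  obtain ⟨ε, hε, hLε⟩ : ∃ ε : ℝ, 0 < ε ∧ (L : ℝ) * ε < δ / 2 := by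
    refine ⟨δ / (2 * ((L : ℝ) + 1)), by positivity, ?_⟩
    rw [mul_div_assoc', div_lt_div_iff₀ (by positivity) (by positivity)]
    nlinarith [L.coe_nonneg]
  have hcl := hclose ε hε
  rw [Metric.tendsto_atTop] at hcl
  obtain ⟨N, hN⟩ := hcl (δ / (2 * (C + 1))) (by positivity)
  refine ⟨N, fun n hn => ?_⟩
  specialize hN n hn
  rw [Real.dist_eq, sub_zero, abs_of_nonneg measureReal_nonneg] at hN
  rw [Real.dist_eq, ← hBn n, ← integral_sub (integrable_comp_of_lipschitz_of_bounded (hA n) hL hbd)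
    (integrable_comp_of_lipschitz_of_bounded (hB n) hL hbd)]
  -- a measurable version of the exceptional set
  have hdist : AEMeasurable (fun ω => dist (A n ω) (B n ω)) (Q n) := (hA n).dist (hB n)
  set D := hdist.mk _ with hD
  set S : Set (Ωs n) := {ω | ε ≤ dist (A n ω) (B n ω)} with hS
  set S' : Set (Ωs n) := {ω | ε ≤ D ω} with hS'
  have hS'm : MeasurableSet S' := measurableSet_le measurable_const hdist.measurable_mk
  have hSS' : S' =ᵐ[Q n] S := by
    filter_upwards [hdist.ae_eq_mk] with ω hω
    change (ε ≤ D ω) = (ε ≤ dist (A n ω) (B n ω))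
    rw [show D ω = dist (A n ω) (B n ω) from hω.symm]
  have hpt : ∀ᵐ ω ∂Q n, |f (A n ω) - f (B n ω)| ≤ (L : ℝ) * ε + C * S'.indicator 1 ω := by
    filter_upwards [hdist.ae_eq_mk] with ω hω
    by_cases hω' : ω ∈ S'
    · rw [Set.indicator_of_mem hω', Pi.one_apply, mul_one]
      have := hC (A n ω) (B n ω)
      rw [Real.dist_eq] at this
      nlinarith [L.coe_nonneg, hε.le]
    · rw [Set.indicator_of_notMem hω', mul_zero, add_zero]
      have hlt : dist (A n ω) (B n ω) < ε := by
        rw [show dist (A n ω) (B n ω) = D ω from hω]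
        exact not_le.1 hω'
      calc |f (A n ω) - f (B n ω)| = dist (f (A n ω)) (f (B n ω)) := (Real.dist_eq _ _).symm
        _ ≤ L * dist (A n ω) (B n ω) := hL.dist_le_mul _ _
        _ ≤ L * ε := by gcongr
  have hind : Integrable (S'.indicator (1 : Ωs n → ℝ)) (Q n) :=
    (integrable_const (1 : ℝ)).indicator hS'm
  calc |∫ ω, (f (A n ω) - f (B n ω)) ∂Q n|
      ≤ ∫ ω, |f (A n ω) - f (B n ω)| ∂Q n := abs_integral_le_integral_abs
    _ ≤ ∫ ω, ((L : ℝ) * ε + C * S'.indicator 1 ω) ∂Q n :=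
        integral_mono_ae (integrable_comp_of_lipschitz_of_bounded (hA n) hL hbd |>.sub
          (integrable_comp_of_lipschitz_of_bounded (hB n) hL hbd)).abs
          ((integrable_const _).add (hind.const_mul C)) hpt
    _ = (L : ℝ) * ε + C * (Q n).real S := by
        rw [integral_add (integrable_const _) (hind.const_mul C), integral_const,
          probReal_univ, one_smul, integral_const_mul, integral_indicator_one hS'm,
          measureReal_congr hSS']
    _ < δ / 2 + δ / 2 := by
        refine add_lt_add hLε ?_
        calc C * (Q n).real S ≤ C * (δ / (2 * (C + 1))) := by gcongr
          _ < δ / 2 := by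
            rw [mul_div_assoc', div_lt_div_iff₀ (by positivity) (by positivity)]
            nlinarith
    _ = δ := by ring

end Coupling


/-! ### The named fact reduced to the single core J (joint law) -/

/-- **Stoll's invariance principle from the joint-law core alone.** With core U discharged by
Lawler's (6.7) (`exists_forall_expect_exp_neg_mul_jbar_le`, from `Lawler1991_eq67_holds`), the
named fact `Stoll1989_invariance` follows from (J): for every `g > 0`, every planar Brownian
motion `Z` and every `L²` limit `γ` of its centred mollified self-intersection local times, the
pairs (rescaled polygonal `n`-step walk, `(g/2)J̄_n`) under the simple random walk converge in law
on `C([0,1], ℂ) × ℝ` to (`t ↦ Z_t`, `gγ`) — the invariance principle for the renormalised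
intersection local time jointly with the path (§§1–2 and Cor. 2.5 (ii) of the source, with
Donsker's theorem), which remains to be formalised.
[cite: Stoll1989, §3, Main Theorem 3.3 and Cor. 3.4 (ii); Cor. 2.5 (ii)] -/
theorem Stoll1989_invariance_of_jointLaw
    (hJ : ∀ (g : ℝ), 0 < g →
      ∀ (Ω : Type u) [MeasurableSpace Ω] (P : Measure Ω) [IsProbabilityMeasure P]
        (Z : ℝ≥0 → Ω → ℂ), Literature.Probability.Process.IsBrownianComplex Z P →
        (∀ t, Measurable (Z t)) → ∀ hc : ∀ ω, Continuous (Z · ω),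
        ∀ γ : Ω → ℝ, MemLp γ 2 P →
          Tendsto (fun k : ℕ => eLpNorm (fun ω =>
            (mollifiedSILT Z k ω - ∫ ω', mollifiedSILT Z k ω' ∂P) - γ ω) 2 P) atTop (𝓝 0) →
          ∀ φ : C(I, ℂ) × ℝ →ᵇ ℝ,
            Tendsto (fun n => 𝔼 ω : StepSeq n, φ (scaledPath n ω, g / 2 * jbar n ω)) atTop
              (𝓝 (∫ ω, φ ((⟨fun t : I => Z (Real.toNNReal (t : ℝ)) ω,
                (hc ω).comp (continuous_real_toNNReal.comp continuous_subtype_val)⟩ : C(I, ℂ)),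
                g * γ ω) ∂P))) :
    Stoll1989_invariance.{u} :=
  Stoll1989_invariance_of_core hJ fun _ hg => exists_forall_expect_exp_neg_mul_jbar_le hg

/-! ### The mollified self-intersection functional on path space

`Φ_k(p) = ∫₀¹∫₀¹ g_k(p(s) - p(t)) ds dt` for a continuous planar path `p : C([0,1], ℂ)` (Le Gall's
Gaussian kernels `g_k = gaussKernel k`, whose elementary bounds come from
`PlanarEdwardsModelDiffusiveSILTMoments`); `mollifiedSILT Z k ω = Φ_k(t ↦ Z_t ω)`. Written out
in full at each occurrence (no new definition). -/

/-- Joint continuity of the inner mollified integral `(p, s) ↦ ∫₀¹ g_k(p(s) - p(t)) dt` on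
`C([0,1], ℂ) × ℝ` (dominated convergence). [folklore] -/
theorem continuous_inner_mollify (k : ℕ) :
    Continuous fun q : C(I, ℂ) × ℝ =>
      ∫ t in Set.Icc (0 : ℝ) 1, gaussKernel k (q.1 (Set.projIcc (0 : ℝ) 1 zero_le_one q.2) - q.1 (Set.projIcc (0 : ℝ) 1 zero_le_one t)) := by
  refine continuous_of_dominated (bound := fun _ => (k : ℝ) / (2 * Real.pi)) ?_ ?_ ?_ ?_
  · intro q
    exact (Continuous.aestronglyMeasurable <| (continuous_gaussKernel k).comp
      (continuous_const.sub (q.1.continuous.comp continuous_projIcc)))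
  · exact fun q => ae_of_all _ fun t => norm_gaussKernel_le k _
  · exact (integrableOn_const (measure_Icc_lt_top (a := (0:ℝ)) (b := 1)).ne)
  · refine ae_of_all _ fun t => (continuous_gaussKernel k).comp ?_
    refine Continuous.sub ?_ ?_
    · exact continuous_eval.comp (continuous_fst.prodMk
        ((continuous_projIcc (h := zero_le_one)).comp continuous_snd))
    · exact (continuous_eval_const (Set.projIcc (0 : ℝ) 1 zero_le_one t)).comp continuous_fst


/-- The inner mollified integral is bounded by `k/(2π)`. [folklore] -/
theorem norm_inner_mollify_le (k : ℕ) (p : C(I, ℂ)) (s : ℝ) :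
    ‖∫ t in Set.Icc (0 : ℝ) 1, gaussKernel k (p (Set.projIcc (0 : ℝ) 1 zero_le_one s) - p (Set.projIcc (0 : ℝ) 1 zero_le_one t))‖ ≤ k / (2 * Real.pi) := by
  refine (norm_setIntegral_le_of_norm_le_const measure_Icc_lt_top
    fun t _ => norm_gaussKernel_le k _).trans ?_
  rw [Real.volume_real_Icc_of_le zero_le_one, sub_zero, mul_one]

/-- **Continuity of the mollified self-intersection functional** `p ↦ ∫₀¹∫₀¹ g_k(p(s) - p(t)) ds dt`
on `C([0,1], ℂ)` (uniform topology), by dominated convergence. [folklore] -/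
theorem continuous_mollify (k : ℕ) : Continuous fun p : C(I, ℂ) => (∫ s in Set.Icc (0 : ℝ) 1, ∫ t in Set.Icc (0 : ℝ) 1,
        gaussKernel k (p (Set.projIcc (0 : ℝ) 1 zero_le_one s) -
          p (Set.projIcc (0 : ℝ) 1 zero_le_one t))) := by
  have h1 : ∀ p : C(I, ℂ),
      Continuous fun s : ℝ => ∫ t in Set.Icc (0 : ℝ) 1, gaussKernel k (p (Set.projIcc (0 : ℝ) 1 zero_le_one s) - p (Set.projIcc (0 : ℝ) 1 zero_le_one t)) :=
    fun p => ((continuous_inner_mollify k).comp (Continuous.prodMk_right p)).congr fun _ => rfl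
  refine continuous_of_dominated (bound := fun _ => (k : ℝ) / (2 * Real.pi)) ?_ ?_ ?_ ?_
  · exact fun p => (h1 p).aestronglyMeasurable
  · exact fun p => ae_of_all _ fun s => norm_inner_mollify_le k p s
  · exact integrableOn_const measure_Icc_lt_top.ne
  · exact ae_of_all _ fun s =>
      ((continuous_inner_mollify k).comp (Continuous.prodMk_left s)).congr fun _ => rfl

/-- `|∫₀¹∫₀¹ g_k(p(s) - p(t)) ds dt| ≤ k/(2π)`. [folklore] -/
theorem norm_mollify_le (k : ℕ) (p : C(I, ℂ)) : ‖(∫ s in Set.Icc (0 : ℝ) 1, ∫ t in Set.Icc (0 : ℝ) 1,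
        gaussKernel k (p (Set.projIcc (0 : ℝ) 1 zero_le_one s) -
          p (Set.projIcc (0 : ℝ) 1 zero_le_one t)))‖ ≤ k / (2 * Real.pi) := by
  refine (norm_setIntegral_le_of_norm_le_const measure_Icc_lt_top
    fun s _ => norm_inner_mollify_le k p s).trans ?_
  rw [Real.volume_real_Icc_of_le zero_le_one, sub_zero, mul_one]

/-- The mollified self-intersection functional as a bounded continuous function on path space
(times a coupling constant `g`). [folklore] -/
theorem exists_boundedContinuous_mollify (k : ℕ) (g : ℝ) :
    ∃ Ψ : C(I, ℂ) →ᵇ ℝ, ∀ p, Ψ p = g * (∫ s in Set.Icc (0 : ℝ) 1, ∫ t in Set.Icc (0 : ℝ) 1,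
        gaussKernel k (p (Set.projIcc (0 : ℝ) 1 zero_le_one s) -
          p (Set.projIcc (0 : ℝ) 1 zero_le_one t))) :=
  ⟨BoundedContinuousFunction.ofNormedAddCommGroup (fun p => g * (∫ s in Set.Icc (0 : ℝ) 1, ∫ t in Set.Icc (0 : ℝ) 1,
        gaussKernel k (p (Set.projIcc (0 : ℝ) 1 zero_le_one s) -
          p (Set.projIcc (0 : ℝ) 1 zero_le_one t))))
    (continuous_const.mul (continuous_mollify k)) (‖g‖ * (k / (2 * Real.pi)))
    fun p => by rw [norm_mul]; exact mul_le_mul_of_nonneg_left (norm_mollify_le k p) (norm_nonneg _),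
    fun _ => rfl⟩

/-- **`mollifiedSILT` is the path functional evaluated on the path**: for a process `Z` with
continuous paths, `T_k(ω) = ∫₀¹∫₀¹ g_k(Z_s ω - Z_t ω) ds dt = Φ_k(t ↦ Z_t ω)`. [cite: LeGall1985, §0, (0-b)] -/
theorem mollifiedSILT_eq_mollify_path {Ω : Type*} (Z : ℝ≥0 → Ω → ℂ) (hc : ∀ ω, Continuous (Z · ω))
    (k : ℕ) (ω : Ω) :
    mollifiedSILT Z k ω = (∫ s in Set.Icc (0 : ℝ) 1, ∫ t in Set.Icc (0 : ℝ) 1,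
        gaussKernel k (((⟨fun t : I => Z (Real.toNNReal (t : ℝ)) ω,
      (hc ω).comp (continuous_real_toNNReal.comp continuous_subtype_val)⟩ : C(I, ℂ))) (Set.projIcc (0 : ℝ) 1 zero_le_one s) -
          ((⟨fun t : I => Z (Real.toNNReal (t : ℝ)) ω,
      (hc ω).comp (continuous_real_toNNReal.comp continuous_subtype_val)⟩ : C(I, ℂ))) (Set.projIcc (0 : ℝ) 1 zero_le_one t))) := by
  unfold mollifiedSILT
  refine setIntegral_congr_fun measurableSet_Icc fun s hs => ?_
  refine setIntegral_congr_fun measurableSet_Icc fun t ht => ?_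
  simp only [ContinuousMap.coe_mk, Set.projIcc_of_mem zero_le_one hs, Set.projIcc_of_mem zero_le_one ht]

/-! ### Convergence in law of pairs from approximation by continuous functionals

A Billingsley-Theorem-3.2-type lemma on varying probability spaces: if `X_n → X'` in law and the
real companions `H_n`, `H'` are approximated in `L¹` — uniformly in large `n` on the discrete
side — by centred bounded continuous functionals `Ψ_k(X_n) - EΨ_k(X_n)`, `Ψ_k(X') - EΨ_k(X')`,
then `(X_n, H_n) → (X', H')` in law. -/

section PairApprox

variable {E : Type*} [PseudoMetricSpace E] [MeasurableSpace E] [OpensMeasurableSpace E]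

/-- A bounded continuous (e.g. Lipschitz) function of a random element is integrable (finite
measure). [folklore] -/
theorem integrable_comp_of_continuous_of_bounded {X : Type*} [MeasurableSpace X] {ν : Measure X}
    [IsFiniteMeasure ν] {Y : X → E} (hY : AEMeasurable Y ν) {f : E → ℝ} (hf : Continuous f)
    {K : ℝ} (hK : ∀ x, ‖f x‖ ≤ K) : Integrable (fun x => f (Y x)) ν :=
  Integrable.mono' (integrable_const K) (hf.measurable.comp_aemeasurable hY).aestronglyMeasurable
    (ae_of_all _ fun _ => hK _)

/-- Lipschitz dependence of `∫ f(Y, U)` on the real companion `U`: for `f` `L`-Lipschitz on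
`E × ℝ` and bounded, `|∫ f(Y, U) - ∫ f(Y, V)| ≤ L ∫ |U - V|`. [folklore] -/
theorem abs_integral_comp_pair_sub_le {X : Type*} [MeasurableSpace X] {ν : Measure X}
    [IsFiniteMeasure ν] {Y : X → E} (hY : AEMeasurable Y ν) {U V : X → ℝ} (hU : Integrable U ν)
    (hV : Integrable V ν) {f : E × ℝ → ℝ} {L : ℝ≥0} (hL : LipschitzWith L f) {K : ℝ}
    (hK : ∀ y, ‖f y‖ ≤ K) :
    |∫ x, f (Y x, U x) ∂ν - ∫ x, f (Y x, V x) ∂ν| ≤ L * ∫ x, |U x - V x| ∂ν := by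
  have hiU : Integrable (fun x => f (Y x, U x)) ν :=
    integrable_comp_of_continuous_of_bounded (hY.prodMk hU.aemeasurable) hL.continuous hK
  have hiV : Integrable (fun x => f (Y x, V x)) ν :=
    integrable_comp_of_continuous_of_bounded (hY.prodMk hV.aemeasurable) hL.continuous hK
  rw [← integral_sub hiU hiV, ← integral_const_mul]
  refine (abs_integral_le_integral_abs).trans (integral_mono_of_nonneg (ae_of_all _ fun _ =>
    abs_nonneg _) ((hU.sub hV).abs.const_mul _) (ae_of_all _ fun x => ?_))
  calc |f (Y x, U x) - f (Y x, V x)| = dist (f (Y x, U x)) (f (Y x, V x)) := (Real.dist_eq _ _).symm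
    _ ≤ L * dist (Y x, U x) (Y x, V x) := hL.dist_le_mul _ _
    _ = L * |U x - V x| := by
        rw [Prod.dist_eq, dist_self, max_eq_right dist_nonneg, Real.dist_eq]

variable [BorelSpace E]
  {Ωs : ℕ → Type*} [∀ n, MeasurableSpace (Ωs n)] {μ : ∀ n, Measure (Ωs n)}
  [∀ n, IsProbabilityMeasure (μ n)] {Ω' : Type*} [MeasurableSpace Ω'] {P : Measure Ω'}
  [IsProbabilityMeasure P] {X : ∀ n, Ωs n → E} {H : ∀ n, Ωs n → ℝ} {X' : Ω' → E} {H' : Ω' → ℝ}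

omit [OpensMeasurableSpace E] in
/-- **Convergence in law of pairs from approximation by continuous functionals** (a
Billingsley-Theorem-3.2-type statement, varying probability spaces). If `X_n → X'` in law,
and for bounded continuous functionals `Ψ_k` the centred variables `Ψ_k(X') - EΨ_k(X')`
converge to `H'` in `L¹` as `k → ∞` while `Ψ_k(X_n) - EΨ_k(X_n)` approximate `H_n` in `L¹` within
any `ε > 0` for all large `k` and then all large `n`, then `(X_n, H_n) → (X', H')` in law.
[cite: Billingsley1999, Theorem 3.2] -/
theorem tendsto_integral_pair_of_approx (hX : ∀ n, AEMeasurable (X n) (μ n))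
    (hH : ∀ n, Integrable (H n) (μ n)) (hX' : AEMeasurable X' P) (hH' : Integrable H' P)
    (hlawX : ∀ ψ : E →ᵇ ℝ,
      Tendsto (fun n => ∫ ω, ψ (X n ω) ∂μ n) atTop (𝓝 (∫ ω, ψ (X' ω) ∂P)))
    (Ψ : ℕ → E →ᵇ ℝ)
    (hlim : Tendsto (fun k => ∫ ω, |(Ψ k (X' ω) - ∫ ω', Ψ k (X' ω') ∂P) - H' ω| ∂P) atTop (𝓝 0))
    (hunif : ∀ ε : ℝ, 0 < ε → ∀ᶠ k in atTop, ∀ᶠ n in atTop,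
      ∫ ω, |(Ψ k (X n ω) - ∫ ω', Ψ k (X n ω') ∂μ n) - H n ω| ∂μ n ≤ ε)
    (φ : E × ℝ →ᵇ ℝ) :
    Tendsto (fun n => ∫ ω, φ (X n ω, H n ω) ∂μ n) atTop (𝓝 (∫ ω, φ (X' ω, H' ω) ∂P)) := by
  have hpair : ∀ n, AEMeasurable (fun ω => (X n ω, H n ω)) (μ n) :=
    fun n => (hX n).prodMk (hH n).aemeasurable
  have hpair' : AEMeasurable (fun ω => (X' ω, H' ω)) P := hX'.prodMk hH'.aemeasurable
  -- a base point of `E` (the target space is nonempty since `P` is a probability measure)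
  have hE : Nonempty E := by
    by_contra h
    rw [not_nonempty_iff] at h
    haveI : IsEmpty Ω' := ⟨fun ω => h.false (X' ω)⟩
    exact zero_ne_one ((measure_univ (μ := P)).symm.trans (by rw [Set.univ_eq_empty_iff.2 ‹_›,
      measure_empty]) |>.symm)
  obtain ⟨x₀⟩ := hE
  -- package the laws of the pairs
  set νs : ℕ → ProbabilityMeasure (E × ℝ) :=
    fun n => ⟨(μ n).map fun ω => (X n ω, H n ω), Measure.isProbabilityMeasure_map (hpair n)⟩
    with hνs
  set ν : ProbabilityMeasure (E × ℝ) :=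
    ⟨P.map fun ω => (X' ω, H' ω), Measure.isProbabilityMeasure_map hpair'⟩ with hν
  suffices h : Tendsto νs atTop (𝓝 ν) by
    have := (ProbabilityMeasure.tendsto_iff_forall_integral_tendsto.1 h) φ
    simp only [hνs, hν, ProbabilityMeasure.coe_mk] at this
    rw [integral_map hpair' φ.continuous.aestronglyMeasurable] at this
    refine this.congr fun n => ?_
    rw [integral_map (hpair n) φ.continuous.aestronglyMeasurable]
  rw [tendsto_iff_forall_lipschitz_integral_tendsto]
  rintro f ⟨C, hC⟩ ⟨L, hL⟩
  simp only [hνs, hν, ProbabilityMeasure.coe_mk]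
  rw [integral_map hpair' hL.continuous.aestronglyMeasurable]
  simp_rw [integral_map (hpair _) hL.continuous.aestronglyMeasurable]
  -- boundedness of `f`
  have hC0 : 0 ≤ C := dist_nonneg.trans (hC (x₀, 0) (x₀, 0))
  have hbd : ∀ y, ‖f y‖ ≤ ‖f (x₀, 0)‖ + C := fun y => by
    have h1 := hC y (x₀, 0)
    rw [Real.dist_eq] at h1
    have h2 := abs_add_le (f (x₀, 0)) (f y - f (x₀, 0))
    rw [add_sub_cancel] at h2
    exact h2.trans (add_le_add le_rfl h1)
  set K := ‖f (x₀, 0)‖ + C with hK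
  rw [Metric.tendsto_atTop]
  intro δ hδ
  have hL1 : (0 : ℝ) < (L : ℝ) + 1 := by positivity
  set η : ℝ := δ / (4 * ((L : ℝ) + 1)) with hη
  have hη0 : 0 < η := by positivity
  have hLη : (L : ℝ) * η < δ / 4 := by
    rw [hη, mul_div_assoc', div_lt_div_iff₀ (by positivity) (by positivity)]
    nlinarith [L.coe_nonneg]
  -- choose the approximation level `k`
  obtain ⟨k, hk1, hk2⟩ := (((tendsto_order.1 hlim).2 η hη0).and (hunif η hη0)).exists
  set c : ℝ := ∫ ω', Ψ k (X' ω') ∂P with hc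
  set cn : ℕ → ℝ := fun n => ∫ ω', Ψ k (X n ω') ∂μ n with hcn
  have hcnc : Tendsto cn atTop (𝓝 c) := hlawX (Ψ k)
  -- the bounded continuous test function `x ↦ f (x, Ψ_k x - c)`
  obtain ⟨ψ, hψ⟩ : ∃ ψ : E →ᵇ ℝ, ∀ x, ψ x = f (x, Ψ k x - c) :=
    ⟨BoundedContinuousFunction.ofNormedAddCommGroup (fun x => f (x, Ψ k x - c))
      (hL.continuous.comp (continuous_id.prodMk ((Ψ k).continuous.sub continuous_const))) K
      fun x => hbd _, fun _ => rfl⟩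
  have e3 := hlawX ψ
  simp_rw [hψ] at e3
  -- gather the three eventualities in `n`
  have hev : ∀ᶠ n in atTop,
      dist (∫ ω, f (X n ω, Ψ k (X n ω) - c) ∂μ n) (∫ ω, f (X' ω, Ψ k (X' ω) - c) ∂P) < δ / 4 ∧
      dist (cn n) c < η ∧
      ∫ ω, |(Ψ k (X n ω) - cn n) - H n ω| ∂μ n ≤ η :=
    ((Metric.tendsto_nhds.1 e3) _ (by positivity)).and
      (((Metric.tendsto_nhds.1 hcnc) _ hη0).and hk2)
  obtain ⟨N, hN⟩ := eventually_atTop.1 hev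
  refine ⟨N, fun n hn => ?_⟩
  obtain ⟨h1, h2, h3⟩ := hN n hn
  rw [Real.dist_eq] at h1 h2 ⊢
  -- the four differences
  have hiΨn : Integrable (fun ω => Ψ k (X n ω) - cn n) (μ n) :=
    (integrable_comp_of_continuous_of_bounded (hX n) (Ψ k).continuous
      ((Ψ k).norm_coe_le_norm)).sub (integrable_const _)
  have hiΨnc : Integrable (fun ω => Ψ k (X n ω) - c) (μ n) :=
    (integrable_comp_of_continuous_of_bounded (hX n) (Ψ k).continuous
      ((Ψ k).norm_coe_le_norm)).sub (integrable_const _)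
  have hiΨ' : Integrable (fun ω => Ψ k (X' ω) - c) P :=
    (integrable_comp_of_continuous_of_bounded hX' (Ψ k).continuous
      ((Ψ k).norm_coe_le_norm)).sub (integrable_const _)
  have d1 : |∫ ω, f (X n ω, H n ω) ∂μ n - ∫ ω, f (X n ω, Ψ k (X n ω) - cn n) ∂μ n| < δ / 4 := by
    refine (abs_integral_comp_pair_sub_le (hX n) (hH n) hiΨn hL hbd).trans_lt ?_
    refine lt_of_le_of_lt ?_ hLη
    refine mul_le_mul_of_nonneg_left ?_ L.coe_nonneg
    refine le_trans (le_of_eq (integral_congr_ae (ae_of_all _ fun ω => ?_))) h3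
    exact abs_sub_comm _ _
  have d2 : |∫ ω, f (X n ω, Ψ k (X n ω) - cn n) ∂μ n - ∫ ω, f (X n ω, Ψ k (X n ω) - c) ∂μ n| <
      δ / 4 := by
    refine (abs_integral_comp_pair_sub_le (hX n) hiΨn hiΨnc hL hbd).trans_lt ?_
    refine lt_of_le_of_lt ?_ hLη
    refine mul_le_mul_of_nonneg_left ?_ L.coe_nonneg
    have : ∀ ω, |(Ψ k (X n ω) - cn n) - (Ψ k (X n ω) - c)| = |cn n - c| := fun ω => by
      rw [show (Ψ k (X n ω) - cn n) - (Ψ k (X n ω) - c) = -(cn n - c) by ring, abs_neg]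
    simp_rw [this, integral_const, probReal_univ, one_smul]
    exact h2.le
  have d4 : |∫ ω, f (X' ω, Ψ k (X' ω) - c) ∂P - ∫ ω, f (X' ω, H' ω) ∂P| < δ / 4 := by
    refine (abs_integral_comp_pair_sub_le hX' hiΨ' hH' hL hbd).trans_lt ?_
    refine lt_of_le_of_lt (mul_le_mul_of_nonneg_left hk1.le L.coe_nonneg) hLη
  have := abs_sub_le (∫ ω, f (X n ω, H n ω) ∂μ n) (∫ ω, f (X n ω, Ψ k (X n ω) - cn n) ∂μ n)
    (∫ ω, f (X' ω, H' ω) ∂P)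
  have := abs_sub_le (∫ ω, f (X n ω, Ψ k (X n ω) - cn n) ∂μ n)
    (∫ ω, f (X n ω, Ψ k (X n ω) - c) ∂μ n) (∫ ω, f (X' ω, H' ω) ∂P)
  have := abs_sub_le (∫ ω, f (X n ω, Ψ k (X n ω) - c) ∂μ n)
    (∫ ω, f (X' ω, Ψ k (X' ω) - c) ∂P) (∫ ω, f (X' ω, H' ω) ∂P)
  linarith

end PairApprox


/-! ### Core J from Donsker's theorem and the discrete mollification estimate -/


/-- **Core (J) — the joint law — from two classical inputs.** For every `g > 0`, every planar
Brownian motion `Z` (continuous paths, measurable marginals) and every `L²` limit `γ` of its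
centred mollified self-intersection local times, the pairs (rescaled polygonal walk,
`(g/2)J̄_n`) under the simple random walk converge in law on `C([0,1], ℂ) × ℝ` to (`t ↦ Z_t`,
`gγ`), PROVIDED (D) **Donsker's invariance principle** for the planar simple random walk
(polygonal interpolation, diffusive scaling `Δx = √(2Δt)`, uniform topology, limit any planar
Brownian motion) and (α) **the discrete renormalisation estimate**: the centred Gaussian
mollifications `Φ_k(W̄_n) - ⟨Φ_k(W̄_n)⟩` of the rescaled walk approximate `J̄_n/2 = (J - ⟨J⟩)/n` in
`L¹(P)` within any `ε > 0` for all large `k` and then all large `n` (the random-walk side of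
Varadhan's renormalisation, uniform in the lattice spacing — the content of Thm. 2.4/Cor. 2.5 and
Theorem 15 (iii), (2) of the source). The Brownian side of the `k → ∞` limit is exactly the
fact's hypothesis on `γ`; the assembly is `tendsto_integral_pair_of_approx`.
[cite: Stoll1989, §2 (Thm. 2.4, Cor. 2.5 (ii)) and §3 (Cor. 3.4); BiBoS II version Thm. 15]
[cite: Billingsley1999, Theorem 3.2 and Theorem 8.2 (Donsker)] -/
theorem jointLaw_of_donsker_of_mollify
    (hD : ∀ (Ω : Type u) [MeasurableSpace Ω] (P : Measure Ω) [IsProbabilityMeasure P]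
      (Z : ℝ≥0 → Ω → ℂ), Literature.Probability.Process.IsBrownianComplex Z P →
      (∀ t, Measurable (Z t)) → ∀ hc : ∀ ω, Continuous (Z · ω),
      ∀ ψ : C(I, ℂ) →ᵇ ℝ,
        Tendsto (fun n => 𝔼 ω : StepSeq n, ψ (scaledPath n ω)) atTop
          (𝓝 (∫ ω, ψ ((⟨fun t : I => Z (Real.toNNReal (t : ℝ)) ω,
            (hc ω).comp (continuous_real_toNNReal.comp continuous_subtype_val)⟩ : C(I, ℂ))) ∂P)))
    (hα : ∀ ε : ℝ, 0 < ε → ∀ᶠ k : ℕ in atTop, ∀ᶠ n : ℕ in atTop,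
      𝔼 ω : StepSeq n, |((∫ s in Set.Icc (0 : ℝ) 1, ∫ t in Set.Icc (0 : ℝ) 1,
        gaussKernel k ((scaledPath n ω) (Set.projIcc (0 : ℝ) 1 zero_le_one s) -
          (scaledPath n ω) (Set.projIcc (0 : ℝ) 1 zero_le_one t))) - 𝔼 ω' : StepSeq n, (∫ s in Set.Icc (0 : ℝ) 1, ∫ t in Set.Icc (0 : ℝ) 1,
        gaussKernel k ((scaledPath n ω') (Set.projIcc (0 : ℝ) 1 zero_le_one s) -
          (scaledPath n ω') (Set.projIcc (0 : ℝ) 1 zero_le_one t)))) -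
        jbar n ω / 2| ≤ ε)
    (g : ℝ) (hg : 0 < g) (Ω : Type u) [MeasurableSpace Ω] (P : Measure Ω) [IsProbabilityMeasure P]
    (Z : ℝ≥0 → Ω → ℂ) (hZ : Literature.Probability.Process.IsBrownianComplex Z P)
    (hm : ∀ t, Measurable (Z t)) (hc : ∀ ω, Continuous (Z · ω)) (γ : Ω → ℝ) (hγ : MemLp γ 2 P)
    (hlim : Tendsto (fun k : ℕ => eLpNorm (fun ω =>
      (mollifiedSILT Z k ω - ∫ ω', mollifiedSILT Z k ω' ∂P) - γ ω) 2 P) atTop (𝓝 0))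
    (φ : C(I, ℂ) × ℝ →ᵇ ℝ) :
    Tendsto (fun n => 𝔼 ω : StepSeq n, φ (scaledPath n ω, g / 2 * jbar n ω)) atTop
      (𝓝 (∫ ω, φ ((⟨fun t : I => Z (Real.toNNReal (t : ℝ)) ω,
        (hc ω).comp (continuous_real_toNNReal.comp continuous_subtype_val)⟩ : C(I, ℂ)),
        g * γ ω) ∂P)) := by
  -- the path map and the uniform measures
  set path : Ω → C(I, ℂ) := fun ω => ⟨fun t : I => Z (Real.toNNReal (t : ℝ)) ω,
    (hc ω).comp (continuous_real_toNNReal.comp continuous_subtype_val)⟩ with hpath_def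
  have hpath : Measurable path := measurable_pathMap Z hm hc
  set μ : ∀ n, Measure (StepSeq n) := fun n => uniformOn Set.univ with hμ
  haveI : ∀ n, IsProbabilityMeasure (μ n) := fun n => by rw [hμ]; infer_instance
  -- the approximating functionals `Ψ_k = g Φ_k`
  choose Ψ hΨ using fun k => exists_boundedContinuous_mollify k g
  -- `T_k = Φ_k ∘ path`
  have hT : ∀ k ω, mollifiedSILT Z k ω = (∫ s in Set.Icc (0 : ℝ) 1, ∫ t in Set.Icc (0 : ℝ) 1,
        gaussKernel k ((path ω) (Set.projIcc (0 : ℝ) 1 zero_le_one s) -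
          (path ω) (Set.projIcc (0 : ℝ) 1 zero_le_one t))) := fun k ω =>
    mollifiedSILT_eq_mollify_path Z hc k ω
  have key := tendsto_integral_pair_of_approx (E := C(I, ℂ)) (μ := μ) (P := P)
    (X := fun n => scaledPath n) (H := fun n ω => g / 2 * jbar n ω) (X' := path)
    (H' := fun ω => g * γ ω) (fun n => (Measurable.of_discrete).aemeasurable)
    (fun n => .of_finite) hpath.aemeasurable ((hγ.integrable one_le_two).const_mul g)
    (fun ψ => by simpa [hμ, integral_uniformOn_stepSeq] using hD Ω P Z hZ hm hc ψ) Ψ ?_ ?_ φ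
  · simpa [hμ, integral_uniformOn_stepSeq] using key
  · -- the Brownian side: `g ∫ |(T_k - E T_k) - γ| ≤ g ‖(T_k - E T_k) - γ‖₂ → 0`
    have hF : ∀ k, AEStronglyMeasurable
        (fun ω => (mollifiedSILT Z k ω - ∫ ω', mollifiedSILT Z k ω' ∂P) - γ ω) P := fun k => by
      refine (AEStronglyMeasurable.sub ?_ aestronglyMeasurable_const).sub hγ.aestronglyMeasurable
      rw [show mollifiedSILT Z k = fun ω => (∫ s in Set.Icc (0 : ℝ) 1, ∫ t in Set.Icc (0 : ℝ) 1,
        gaussKernel k ((path ω) (Set.projIcc (0 : ℝ) 1 zero_le_one s) -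
          (path ω) (Set.projIcc (0 : ℝ) 1 zero_le_one t))) from funext (hT k)]
      exact ((continuous_mollify k).measurable.comp hpath).aestronglyMeasurable
    have h1 : ∀ k, ∫ ω, |(Ψ k (path ω) - ∫ ω', Ψ k (path ω') ∂P) - g * γ ω| ∂P =
        g * ∫ ω, |(mollifiedSILT Z k ω - ∫ ω', mollifiedSILT Z k ω' ∂P) - γ ω| ∂P := fun k => by
      rw [← integral_const_mul]
      refine integral_congr_ae (ae_of_all _ fun ω => ?_)
      simp_rw [hΨ, hT, integral_const_mul]
      rw [← abs_of_pos hg, ← abs_mul, abs_of_pos hg]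
      ring_nf
    simp_rw [h1]
    rw [show (0 : ℝ) = g * 0 by ring]
    refine Tendsto.const_mul g ?_
    -- `L¹ ≤ L²` on a probability space
    have hT_bdd : ∀ k ω, ‖mollifiedSILT Z k ω‖ ≤ k / (2 * Real.pi) := fun k ω => by
      rw [hT k ω]; exact norm_mollify_le k _
    have hF2 : ∀ k, MemLp (fun ω => (mollifiedSILT Z k ω - ∫ ω', mollifiedSILT Z k ω' ∂P) - γ ω)
        2 P := fun k => by
      refine (MemLp.sub ?_ (memLp_const _)).sub hγ
      refine MemLp.of_bound ?_ ((k : ℝ) / (2 * Real.pi)) (ae_of_all _ (hT_bdd k))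
      rw [show mollifiedSILT Z k = fun ω => (∫ s in Set.Icc (0 : ℝ) 1, ∫ t in Set.Icc (0 : ℝ) 1,
        gaussKernel k ((path ω) (Set.projIcc (0 : ℝ) 1 zero_le_one s) -
          (path ω) (Set.projIcc (0 : ℝ) 1 zero_le_one t))) from funext (hT k)]
      exact ((continuous_mollify k).measurable.comp hpath).aestronglyMeasurable
    have h2 : ∀ k, ∫ ω, |(mollifiedSILT Z k ω - ∫ ω', mollifiedSILT Z k ω' ∂P) - γ ω| ∂P ≤
        (eLpNorm (fun ω => (mollifiedSILT Z k ω - ∫ ω', mollifiedSILT Z k ω' ∂P) - γ ω) 2 P).toReal :=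
      fun k => by
      have h3 := integral_norm_eq_lintegral_enorm (hF k)
      simp only [Real.norm_eq_abs] at h3
      rw [h3, ← eLpNorm_one_eq_lintegral_enorm]
      exact ENNReal.toReal_mono (hF2 k).eLpNorm_ne_top
        (eLpNorm_le_eLpNorm_of_exponent_le one_le_two (hF k))
    have hup : Tendsto (fun k => (eLpNorm (fun ω =>
        (mollifiedSILT Z k ω - ∫ ω', mollifiedSILT Z k ω' ∂P) - γ ω) 2 P).toReal) atTop (𝓝 0) := by
      have := (ENNReal.tendsto_toReal ENNReal.zero_ne_top).comp hlim
      rwa [ENNReal.toReal_zero] at this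
    exact tendsto_of_tendsto_of_tendsto_of_le_of_le tendsto_const_nhds hup
      (fun k => integral_nonneg fun ω => abs_nonneg _) h2
  · -- the random-walk side: `hα` with `ε/g`
    intro ε hε
    filter_upwards [hα (ε / g) (div_pos hε hg)] with k hk
    filter_upwards [hk] with n hn
    simp_rw [hμ, integral_uniformOn_stepSeq, hΨ]
    have : ∀ ω : StepSeq n, |(g * (∫ s in Set.Icc (0 : ℝ) 1, ∫ t in Set.Icc (0 : ℝ) 1,
        gaussKernel k ((scaledPath n ω) (Set.projIcc (0 : ℝ) 1 zero_le_one s) -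
          (scaledPath n ω) (Set.projIcc (0 : ℝ) 1 zero_le_one t))) - 𝔼 ω' : StepSeq n, g * (∫ s in Set.Icc (0 : ℝ) 1, ∫ t in Set.Icc (0 : ℝ) 1,
        gaussKernel k ((scaledPath n ω') (Set.projIcc (0 : ℝ) 1 zero_le_one s) -
          (scaledPath n ω') (Set.projIcc (0 : ℝ) 1 zero_le_one t)))) -
        g / 2 * jbar n ω| = g * |((∫ s in Set.Icc (0 : ℝ) 1, ∫ t in Set.Icc (0 : ℝ) 1,
        gaussKernel k ((scaledPath n ω) (Set.projIcc (0 : ℝ) 1 zero_le_one s) -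
          (scaledPath n ω) (Set.projIcc (0 : ℝ) 1 zero_le_one t))) - 𝔼 ω' : StepSeq n, (∫ s in Set.Icc (0 : ℝ) 1, ∫ t in Set.Icc (0 : ℝ) 1,
        gaussKernel k ((scaledPath n ω') (Set.projIcc (0 : ℝ) 1 zero_le_one s) -
          (scaledPath n ω') (Set.projIcc (0 : ℝ) 1 zero_le_one t)))) -
        jbar n ω / 2| := fun ω => by
      rw [← Finset.mul_expect, ← abs_of_pos hg, ← abs_mul, abs_of_pos hg]
      ring_nf
    simp_rw [this, ← Finset.mul_expect]
    calc g * _ ≤ g * (ε / g) := by gcongr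
      _ = ε := mul_div_cancel₀ _ hg.ne'

/-- **Stoll's invariance principle from Donsker's theorem and the discrete renormalisation
estimate.** The named fact `Stoll1989_invariance` follows from (D) Donsker's invariance principle
for the planar simple random walk (polygonal paths, `Δx = √(2Δt)`, uniform topology on `[0,1]`,
limit any planar Brownian motion) and (α) the uniform-in-`n` `L¹` approximation of
`J̄_n/2 = (J - ⟨J⟩)/n` by the centred Gaussian mollifications `Φ_k(W̄_n) - ⟨Φ_k(W̄_n)⟩` of the
rescaled walk — everything else (Gibbs-tilt glue = §3 of the source, core U = Lawler's (6.7),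
the Brownian side of the renormalisation = the fact's own hypothesis on `γ`, the two-index
assembly) being PROVED in this file. (D) is Billingsley's Theorem 8.2 in the plane; (α) is the
random-walk half of the invariance principle for the renormalised intersection local time
(Thm. 2.4/Cor. 2.5 of the source; Theorem 15 of the BiBoS II version). Both remain to be
formalised. [cite: Stoll1989, §2 (Thm. 2.4, Cor. 2.5) and §3 (Main Theorem 3.3, Cor. 3.4 (ii))]
[cite: Billingsley1999, Theorem 8.2] -/
theorem Stoll1989_invariance_of_donsker_of_mollify
    (hD : ∀ (Ω : Type u) [MeasurableSpace Ω] (P : Measure Ω) [IsProbabilityMeasure P]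
      (Z : ℝ≥0 → Ω → ℂ), Literature.Probability.Process.IsBrownianComplex Z P →
      (∀ t, Measurable (Z t)) → ∀ hc : ∀ ω, Continuous (Z · ω),
      ∀ ψ : C(I, ℂ) →ᵇ ℝ,
        Tendsto (fun n => 𝔼 ω : StepSeq n, ψ (scaledPath n ω)) atTop
          (𝓝 (∫ ω, ψ ((⟨fun t : I => Z (Real.toNNReal (t : ℝ)) ω,
            (hc ω).comp (continuous_real_toNNReal.comp continuous_subtype_val)⟩ : C(I, ℂ))) ∂P)))
    (hα : ∀ ε : ℝ, 0 < ε → ∀ᶠ k : ℕ in atTop, ∀ᶠ n : ℕ in atTop,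
      𝔼 ω : StepSeq n, |((∫ s in Set.Icc (0 : ℝ) 1, ∫ t in Set.Icc (0 : ℝ) 1,
        gaussKernel k ((scaledPath n ω) (Set.projIcc (0 : ℝ) 1 zero_le_one s) -
          (scaledPath n ω) (Set.projIcc (0 : ℝ) 1 zero_le_one t))) - 𝔼 ω' : StepSeq n, (∫ s in Set.Icc (0 : ℝ) 1, ∫ t in Set.Icc (0 : ℝ) 1,
        gaussKernel k ((scaledPath n ω') (Set.projIcc (0 : ℝ) 1 zero_le_one s) -
          (scaledPath n ω') (Set.projIcc (0 : ℝ) 1 zero_le_one t)))) -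
        jbar n ω / 2| ≤ ε) :
    Stoll1989_invariance.{u} :=
  Stoll1989_invariance_of_jointLaw fun g hg Ω _ P _ Z hZ hm hc γ hγ hlim =>
    jointLaw_of_donsker_of_mollify hD hα g hg Ω P Z hZ hm hc γ hγ hlim

section DonskerAssembly

open Literature.Probability.Process

/-- **Donsker's theorem for the planar walk from tightness and finite-dimensional convergence.**
Core (D) of `Stoll1989_invariance_of_donsker_of_mollify` — weak convergence on `C([0,1], ℂ)` of
the laws of the rescaled polygonal walks `scaledPath n` (uniform measure on the `4ⁿ` walks) to the
law of ANY planar Brownian path — follows from (D-a) tightness of these laws and (D-b)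
convergence of their finite-dimensional distributions to those of planar Brownian motion
(test functions on `I₀ → ℂ`, `I₀ ⊆ [0,1]` finite; by `IsBrownianComplex.map_fdd_eq` the target
does not depend on the Brownian motion): Billingsley's Theorem 7.1
(`Literature.Probability.Process.tendsto_of_isTightMeasureSet_of_tendsto_fdd`, via Prokhorov).
[cite: Billingsley1999, Theorems 7.1 and 7.5] -/
theorem donsker_of_isTightMeasureSet_of_tendsto_fdd
    (htight : IsTightMeasureSet (Set.range fun n : ℕ =>
      (uniformOn (Set.univ : Set (StepSeq n))).map (scaledPath n)))
    (hfdd : ∀ (I₀ : Finset I) (Ω : Type u) [MeasurableSpace Ω] (P : Measure Ω)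
      [IsProbabilityMeasure P] (Z : ℝ≥0 → Ω → ℂ), IsBrownianComplex Z P →
      (∀ t, Measurable (Z t)) → (∀ ω, Continuous (Z · ω)) → ∀ φ : (I₀ → ℂ) →ᵇ ℝ,
      Tendsto (fun n : ℕ => 𝔼 ω : StepSeq n, φ fun i : I₀ => scaledPath n ω i) atTop
        (𝓝 (∫ ω, φ (fun i : I₀ => Z (Real.toNNReal ((i : I) : ℝ)) ω) ∂P)))
    (Ω : Type u) [MeasurableSpace Ω] (P : Measure Ω) [IsProbabilityMeasure P]
    (Z : ℝ≥0 → Ω → ℂ) (hZ : IsBrownianComplex Z P) (hm : ∀ t, Measurable (Z t))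
    (hc : ∀ ω, Continuous (Z · ω)) (ψ : C(I, ℂ) →ᵇ ℝ) :
    Tendsto (fun n => 𝔼 ω : StepSeq n, ψ (scaledPath n ω)) atTop
      (𝓝 (∫ ω, ψ ((⟨fun t : I => Z (Real.toNNReal (t : ℝ)) ω,
        (hc ω).comp (continuous_real_toNNReal.comp continuous_subtype_val)⟩ : C(I, ℂ))) ∂P)) := by
  set path : Ω → C(I, ℂ) := fun ω => ⟨fun t : I => Z (Real.toNNReal (t : ℝ)) ω,
    (hc ω).comp (continuous_real_toNNReal.comp continuous_subtype_val)⟩ with hpath_def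
  have hpath : Measurable path := measurable_pathMap Z hm hc
  -- laws as probability measures
  set μs : ℕ → ProbabilityMeasure C(I, ℂ) := fun n =>
    ⟨(uniformOn (Set.univ : Set (StepSeq n))).map (scaledPath n),
      Measure.isProbabilityMeasure_map (Measurable.of_discrete).aemeasurable⟩ with hμs
  set μ : ProbabilityMeasure C(I, ℂ) := ⟨P.map path, Measure.isProbabilityMeasure_map
    hpath.aemeasurable⟩ with hμ
  suffices h : Tendsto μs atTop (𝓝 μ) by
    have := (ProbabilityMeasure.tendsto_iff_forall_integral_tendsto.1 h) ψ
    simp only [hμs, hμ, ProbabilityMeasure.coe_mk] at this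
    rw [integral_map hpath.aemeasurable ψ.continuous.aestronglyMeasurable] at this
    refine this.congr fun n => ?_
    rw [integral_map (Measurable.of_discrete).aemeasurable ψ.continuous.aestronglyMeasurable,
      integral_uniformOn_stepSeq]
  refine tendsto_of_isTightMeasureSet_of_tendsto_fdd ?_ fun I₀ => ?_
  · convert htight using 1
    ext ν
    simp only [hμs, Set.mem_range, Set.mem_setOf_eq, ProbabilityMeasure.coe_mk]
  · rw [ProbabilityMeasure.tendsto_iff_forall_integral_tendsto]
    intro φ
    have hr := (continuous_restrict_continuousMap (β := ℂ) I₀).measurable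
    have key := hfdd I₀ Ω P Z hZ hm hc φ
    simp only [hμs, hμ, ProbabilityMeasure.toMeasure_map, ProbabilityMeasure.coe_mk]
    rw [Measure.map_map hr hpath, integral_map (hr.comp hpath).aemeasurable
      φ.continuous.aestronglyMeasurable]
    refine (tendsto_congr fun n => ?_).1 key
    rw [Measure.map_map hr (Measurable.of_discrete), integral_map
      (Measurable.of_discrete).aemeasurable φ.continuous.aestronglyMeasurable,
      integral_uniformOn_stepSeq]
    rfl

/-- **Stoll's invariance principle from three classical inputs**: (D-a) tightness on
`C([0,1], ℂ)` of the laws of the rescaled polygonal walks, (D-b) convergence of their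
finite-dimensional distributions to those of planar Brownian motion, and (α) the discrete
renormalisation estimate — Donsker's theorem being assembled from (D-a), (D-b) by Prokhorov
(`donsker_of_isTightMeasureSet_of_tendsto_fdd`). [cite: Billingsley1999, Theorems 7.1, 7.5]
[cite: Stoll1989, §3, Main Theorem 3.3 and Cor. 3.4 (ii)] -/
theorem Stoll1989_invariance_of_isTight_of_fdd_of_mollify
    (htight : IsTightMeasureSet (Set.range fun n : ℕ =>
      (uniformOn (Set.univ : Set (StepSeq n))).map (scaledPath n)))
    (hfdd : ∀ (I₀ : Finset I) (Ω : Type u) [MeasurableSpace Ω] (P : Measure Ω)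
      [IsProbabilityMeasure P] (Z : ℝ≥0 → Ω → ℂ), IsBrownianComplex Z P →
      (∀ t, Measurable (Z t)) → (∀ ω, Continuous (Z · ω)) → ∀ φ : (I₀ → ℂ) →ᵇ ℝ,
      Tendsto (fun n : ℕ => 𝔼 ω : StepSeq n, φ fun i : I₀ => scaledPath n ω i) atTop
        (𝓝 (∫ ω, φ (fun i : I₀ => Z (Real.toNNReal ((i : I) : ℝ)) ω) ∂P)))
    (hα : ∀ ε : ℝ, 0 < ε → ∀ᶠ k : ℕ in atTop, ∀ᶠ n : ℕ in atTop,
      𝔼 ω : StepSeq n, |((∫ s in Set.Icc (0 : ℝ) 1, ∫ t in Set.Icc (0 : ℝ) 1,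
        gaussKernel k ((scaledPath n ω) (Set.projIcc (0 : ℝ) 1 zero_le_one s) -
          (scaledPath n ω) (Set.projIcc (0 : ℝ) 1 zero_le_one t))) -
        𝔼 ω' : StepSeq n, (∫ s in Set.Icc (0 : ℝ) 1, ∫ t in Set.Icc (0 : ℝ) 1,
        gaussKernel k ((scaledPath n ω') (Set.projIcc (0 : ℝ) 1 zero_le_one s) -
          (scaledPath n ω') (Set.projIcc (0 : ℝ) 1 zero_le_one t)))) -
        jbar n ω / 2| ≤ ε) :
    Stoll1989_invariance.{u} :=
  Stoll1989_invariance_of_donsker_of_mollify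
    (fun Ω _ P _ Z hZ hm hc ψ =>
      donsker_of_isTightMeasureSet_of_tendsto_fdd htight hfdd Ω P Z hZ hm hc ψ) hα

/-- **Stoll's invariance principle from finite-dimensional convergence and the discrete
renormalisation estimate.** With tightness PROVED (`isTightMeasureSet_scaledPath`, sibling file
`PlanarEdwardsModelDiffusiveScaledPathTight`), the named fact `Stoll1989_invariance` follows from
(D-b) convergence of the finite-dimensional distributions of the rescaled polygonal walks to those
of planar Brownian motion (the multidimensional central limit theorem for the walk's increments)
and (α) the discrete renormalisation estimate — the two inputs that remain to be formalised.
[cite: Billingsley1999, Theorems 7.1, 7.5, 8.2] [cite: Stoll1989, §3, Main Theorem 3.3 and Cor. 3.4 (ii)] -/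
theorem Stoll1989_invariance_of_fdd_of_mollify
    (hfdd : ∀ (I₀ : Finset I) (Ω : Type u) [MeasurableSpace Ω] (P : Measure Ω)
      [IsProbabilityMeasure P] (Z : ℝ≥0 → Ω → ℂ), IsBrownianComplex Z P →
      (∀ t, Measurable (Z t)) → (∀ ω, Continuous (Z · ω)) → ∀ φ : (I₀ → ℂ) →ᵇ ℝ,
      Tendsto (fun n : ℕ => 𝔼 ω : StepSeq n, φ fun i : I₀ => scaledPath n ω i) atTop
        (𝓝 (∫ ω, φ (fun i : I₀ => Z (Real.toNNReal ((i : I) : ℝ)) ω) ∂P)))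
    (hα : ∀ ε : ℝ, 0 < ε → ∀ᶠ k : ℕ in atTop, ∀ᶠ n : ℕ in atTop,
      𝔼 ω : StepSeq n, |((∫ s in Set.Icc (0 : ℝ) 1, ∫ t in Set.Icc (0 : ℝ) 1,
        gaussKernel k ((scaledPath n ω) (Set.projIcc (0 : ℝ) 1 zero_le_one s) -
          (scaledPath n ω) (Set.projIcc (0 : ℝ) 1 zero_le_one t))) -
        𝔼 ω' : StepSeq n, (∫ s in Set.Icc (0 : ℝ) 1, ∫ t in Set.Icc (0 : ℝ) 1,
        gaussKernel k ((scaledPath n ω') (Set.projIcc (0 : ℝ) 1 zero_le_one s) -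
          (scaledPath n ω') (Set.projIcc (0 : ℝ) 1 zero_le_one t)))) -
        jbar n ω / 2| ≤ ε) :
    Stoll1989_invariance.{u} :=
  Stoll1989_invariance_of_isTight_of_fdd_of_mollify isTightMeasureSet_scaledPath hfdd hα

end DonskerAssembly

end Edwards2D

end Literature.Barriers.CriticalPhenomena

end
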